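import Literature.MathematicalPhysics.QuantumFieldTheory.Balaban1983to89.B7Prop9Flat
import Literature.MathematicalPhysics.QuantumFieldTheory.Balaban1983to89.B7Prop2Explicit

/-!
# `Balaban1983to89.B7Prop9General` — T. Bałaban, *Averaging operations for lattice gauge theories*, Commun. Math. Phys.
**98** (1985) 17–51 [Balaban1985Averaging], Sect. F, **Proposition 9 and (197)–(200) p. 49 AT A GENERAL (curved)
BACKGROUND `V₀`** — kernel form over the concrete model of the `B7Prop1Explicit`/`B7Prop9Flat` lineage, by REDUCTION to the
flat kernels `B7Prop9Flat.core199`/`core200` in the axial gauge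

statement-level skeleton of published theorems with citation tags; proofs where landed; nothing here is a claim about the Yang–Mills mass gap

PDF held: `paper:balaban1985-cmp98-averaging` (journal page = PDF page + 16); renders `…/1985-cmp98-averaging-p029`–`p033-x2.png`
(pp. 45–49), `p008/p009-x2.png` (pp. 24–25), read as images by the unit.

CITATION HEADER (lean-in-tree rule).  Cell `lit-balaban` (HOME `run/shared/lean/pub/lit-balaban/`), unit `lit-balaban-r04`
(reader/typer of block B7, gen 2), an ANNOUNCED reader build (HOME/STATUS.md `TAKING B7.Prop9 → B7Prop9General.lean`,
2026-08-21) — a KERNEL PIECE for SKELETON row `B7.Prop9` (decl of record `B7.Prop9Printed`, abstract; flat kernel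
`B7Prop9Flat.prop9_flat`); rows touched: B7.Prop9, B7.Eq180 (the hypotheses (180) at a general background: `CovBondBd`,
`CovBlockBd`), B7.Eq199 ((197)/(199)), B7.Eq181 ((198)/(200)).  Nothing of the abstract carrier `B7.lean` is instantiated.

PRINT (p. 46 and p. 49, verbatim; the full passage (176)–(200) is quoted in the module docstring of `B7Prop9Flat`).  p. 46: "Let
us assume that we have a gauge field configuration `V₀` satisfying the regularity condition `|V₀(∂p) − 1| < α₀, p ⊂ Ω′`, and two
gauge transformations `v′, v₁` satisfying the conditions `|v′ − 1| < α₄, |v′⁻¹(b₋)R_{0,b}v′(b₊) − 1| < α′₄, |v₁ − 1| < α₃,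
|v₁⁻¹(y)(R₀v₁)(x) − 1| < Lα′₃`, (180) `x ∈ B(y), y ∈ Ω′^{(1)}`."  p. 49: "**Proposition 9.** There exist positive constants
`C′₄, C′₅, c′₆` such that for arbitrary functions `V₀, v′, v₁` satisfying (180) with `α₀, α₃, α′₃, α₄, α′₄ ≦ c′₆`, the following
bounds hold: `|ṽ′⁻¹(c₋)R̄_{0,c}ṽ′(c₊) − 1| < Lα′₄ + C′₄L²(α₀α₄ + α′₃α′₄ + α′₄²)`, (199) `|ṽ′(y) − 1| < α₄ + C′₅Lα′₄`. (200)  In these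
bounds we have assumed that `α′₄ = O(α₄)`, which will always be true here and in forthcoming papers."  Here `ṽ′ =
\overline{R₀v′v₁}(\overline{R₀v₁})⁻¹` ((178)/(179), one step), the averages being the twisted block averages (78) at `V₀`,
`R_{0,b} = R(V_{0,b})`, `(R_{0,y}v)(x) = R(V₀(Γ_{y,x}))v(x)` (p. 27), `R(X)Y = XYX⁻¹` (56), and `R̄_{0,c} = R(V̄₀(c))`, `V̄₀ =
\overline{V₀}` the averaged configuration (42)/(43).

WHAT THIS FILE PROVES (kernel, no `sorry`, standard axioms; all constants explicit).  Setting: `𝔸` a complete normed `ℂ`-algebra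
with `‖1‖ = 1`, background `V₀ : ℤ^d → (Fin d → 𝔸ˣ)` with values in `U1 = {‖u‖ ≤ 1, ‖u⁻¹‖ ≤ 1}` (`B7Prop1Explicit.U1`; contains
`U(N) ⊂ M_N(ℂ)` and the unitary group of every C⋆-algebra) satisfying (52) `‖V₀(∂p) − 1‖ ≤ α₀` on all unit plaquettes; site
functions `v′, v₁ : ℤ^d → 𝔸ˣ`; the twisted site average (78) `B7Eq99Concrete.R0avg L V₀ v y` (= `savg ∘ R0fun`); the one-step
`ṽ′` at the block corner `y = Lz`: `vtilG L V₀ v′ v₁ y := R0avg(v′v₁)(y)·(R0avg v₁ (y))⁻¹` (at `V₀ = 1`: `B7Prop9Flat.vtil`).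
* §2 `CovBondBd V₀ v α` — **(180b)/(177) at `V₀`**: `‖v(x)⁻¹R(V₀(b))v(x + e_κ) − 1‖ ≤ α` on all bonds; `CovBlockBd L V₀ v β` —
  **(180d) at `V₀`**: `‖v(Lz)⁻¹(R_{0,Lz}v)(Lz + r) − 1‖ ≤ β` on all blocks (the `j = 0` shape of (167), `B7Eq167Flat.Cond167`);
  both reduce to `B7Prop9Flat.BondBd/BlockBd` at `V₀ = 1`.
* **`eq200_general`** — (198)/(200): `‖ṽ′(y) − 1‖ ≤ α₄ + C′₅L·(α′₄ + 4dLα₀α₄)`, `C′₅ = 64(d+1)` (`B7Prop9Flat.C5'`), `L ≥ 1`.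
* **`eq199_general_seg`** — (197)/(199) with the STRAIGHT coarse transporter `V₀(c)`, `c = ⟨Lz, L(z+e_μ)⟩`:
  `‖ṽ′(c₋)⁻¹R(V₀(c))ṽ′(c₊) − 1‖ ≤ L·a′ + C′₄L²(α′₃a′ + a′²)`, `a′ = α′₄ + 16(d+1)²L²α₀α₄`, `C′₄ = 10⁴(d+1)²` (`B7Prop9Flat.C4'`).
* **`eq199_general`** — (199) with print's `R̄_{0,c} = R(V̄₀(c))`, `V̄₀(c) = e^{X_c}V₀(c)` (`B7Prop1Explicit.bavg`): the same
  bound `+ 384(d+1)(d+4)L²α₀·(α₄ + C′₅L(α′₄ + 4dLα₀α₄))`, under Prop. 2's `512(d+1)(d+4)L²α₀ ≤ 1`.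
* **`prop9_general`** — Proposition 9 packaged as `prop9_flat` is: the coarse function `z ↦ ṽ′(Lz)` satisfies `CovBondBd` at
  the AVERAGED background `rescale L (bavg L V₀)` (= `avgIter L V₀ 1`) and `SiteBd`, with the two constants above — the
  hypotheses (180a)/(180b) one scale up, i.e. the input of the induction of Proposition 10 at a general background.
THE PROOF (the reduction; print proves (181)–(197) directly at `V₀`).  (i) In the axial gauge `w = V₀(Γ_{y,·})`
(`B7Prop1Explicit.axialFn`) the rotation `(R_{0,y}v)(x) = R(w(x))v(x)` is a pointwise conjugation, so `R̄₀v(y)` IS the FLAT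
average (78) of the rotated function (`R0avg_eq_savg_rotClamp`; definitional), and for the neighbouring block `B(c₊)` the same
holds after the constant rotation `R(V₀(c))` (`savg_Rc`: (78) commutes with constant rotations in `U1`, termwise conjugation of
the series (21), `B7Prop1Explicit.mlog_units_conj`).  (ii) The rotated function is CLAMPED to the block(s) (`rotClamp`, §1):
the flat kernels' bond hypothesis `B7Prop9Flat.BondBd` is global on `ℤ^d`, and the clamped function's bond variables are `1`
or bond variables of the box.  (iii) On the box, `(R(w)v)(p)⁻¹(R(w)v)(p′) = R(w_p)[v_p⁻¹·R(K)(R(V₀(b))v_{p′})]` with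
`K` conjugate to the inverse of the gauge-transformed bond `G = w_pV₀(b)w_{p′}⁻¹`, and `‖R(K)X − X‖ ≤ 2‖K − 1‖‖X − 1‖`
(`norm_Rc_sub_self_le`, the device of (194)), so (180b) transfers with `α′₄ ↦ α′₄ + 4gα₄`, `g` = the bond deviation of `V₀` in
the gauge (`bondBd_rotClamp`).  (iv) `g`: inside a block the bonds in the axial gauge are the thin loops of p. 25,
`‖V₀^{ax}(b) − 1‖ ≤ |b₋ − y|₁α₀` (`B7Prop1Explicit.axial_bond_bound`, itself the non-abelian Stokes ladder estimate); for (199) the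
two blocks carry the gauges "axial at `c₋`" and "`V₀(c)`·axial at `c₊`" (`gauge2`), and the bonds ACROSS the face are the loops
`Γ_{c₋,p} ∪ b ∪ Γ_{c₊,p+e_μ}⁻¹ ∪ (−c)` (print's `Γ_{c,x} ∪ (−c)` of (193)–(195)); `crossing_bound` evaluates them in the axial gauge
at `c₋` as `V^{ax}(b)·V^{ax}(Γ(a) from c₊)·V^{ax}([c₋+a, c₋+a+Le_μ])⁻¹` by splitting tree contours at the direction `μ`
(`treeWord_split`) and bounds each word by `norm_hol_sub_one_le_of_l1` (`≤ |ω|(|x − c₋|₁ + |ω|)α₀`): `g ≤ 4(d+1)²L²α₀`.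
(v) `B7Prop9Flat.setup/core200/core199/arith200/arith199` then give (200)/(199) verbatim with `α′₄ ↦ a′`; (vi) the factor
`e^{X_c}` of `V̄₀(c)`, `‖X_c‖ ≤ 32(d+1)(d+4)L²α₀` (`B7Prop2Explicit.norm_Wcx_sub_one_le`), moves `R(V₀(c))ṽ′(c₊)` (within (200) of
`1`) by `≤ 6‖X_c‖·‖· − 1‖` (`norm_Rc_expUnit_sub_self_le`).
READINGS (recorded; none is an objection to print).  (a) `U1`-VALUED BACKGROUND and the BANACH reading of `|·|` as in the
lineage (`B7Prop9Flat` reading (b)); print: `G ⊂ U(N)`, `R(·)` an isometry.  (b) CONSTANTS: print's `C′₄L²·α₀α₄` in (199) is here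
`16(d+1)²L³α₀α₄ + O(L⁴α₀α₄·(α′₃ + α′₄ + …))`, and (200), which print states WITHOUT an `α₀`-term ((184)/(186) only meet covariant
bond variables along `Γ_{y,x}`), carries `4dC′₅L²α₀α₄`: the flat kernels are used as black boxes and their bond hypothesis is
global, so the non-tree bonds of the block and the crossing loops enter the leading term; all inside print's "there exist positive
constants … depending on `d` (and `L`)" as read in `B7Prop9Flat` (e).  (c) SMALLNESS explicit (`c′₆ = c′₆(d, L)`): `α₄ ≤ 1/10`,
`α₃ ≤ 1/5`, `50Lα′₃ ≤ 1`, `10³(d+1)L·a′ ≤ 1`, `512(d+1)(d+4)L²α₀ ≤ 1`.  (d) LATTICE: all of `ℤ^d` for `Ω′`, blocks `B(Lz) = Lz +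
[0,L)^d`, tree contours `B7Prop1Explicit.treeWord`, coarse bond contour `seg μ L`; `≤` for `<`.  (e) Print does not consume
`|v₁ − 1| < α₃` (row note G-adv4-7); here, as in `prop9_flat`, it feeds the flat kernel's `2/5`-bounds.
DECLARATIONS: 11 definitions (`clampZ clamp (∀ i, boxTop i ≤ CovBlockBd i ∧ CovBlockBd i ≤ CovBondBd i) rotClamp hiPart loPart gauge2 vtilG`),
the rest theorems; imports `B7Prop9Flat`, `B7Prop2Explicit`; everything else REUSED BY NAME (`B7Prop9Flat.setup,
core199, core200, arith199, arith200, SiteBd, BondBd, BlockBd, vtil, C4', C5', length_seg_nat`; `B7Prop1Explicit.axialFn,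
axial_bond_bound, hol_axial_treeWord, hol_gaugeAct, gaugeAct, U1, treeWord, seg, l1, boxVec, bavg, Xavg, Wcx, norm_avg_le,
mlog_units_conj, …`; `B7Prop2Explicit.norm_Wcx_sub_one_le, rescale`; `B7Eq99Concrete.R0avg, R0fun, savg, Sexp`;
`B7Eq84Concrete.savg_congr`; `B7Eq92Concrete.Rc, expUnit_conj`; `MatrixLog.mlog, norm_mlog_le_two_mul`).
Unit `lit-balaban-r04` (gen 2), 2026-08-21.

v1.1 (unit `lit-balaban-r04` gen 22, DOCSTRING-ONLY; every declaration byte-identical with v1.0 p243464): the locator of (197) corrected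
from "p.49" to p. 48 in the header tag and in two `[cite:]` tags (`eq199_general_seg`, `eq199_general`) (own-stem locator audit of the
`[cite: Balaban1985Averaging, …]` tags against a display→page map of CMP 98 built from the held text layer
`paper:balaban1985-cmp98-averaging` and verified on the ×2 renders `…/1985-cmp98-averaging-p0NN-x2.png`: (197) is the last display of p.
48 (render p032); (198)–(206) stand on p. 49 (render p033)).

[cite: Balaban1985Averaging, Proposition 9 p.49, (176)–(179) p.45, (180)–(186) p.46, (187)–(189) p.47, (190)–(197) p.48,
(198)–(200) p.49, (42)–(43) pp.23–24, pp.24–25, (56)–(57) p.27, (78) p.30]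
-/

noncomputable section

open NormedSpace Finset

namespace Literature.MathematicalPhysics.QuantumFieldTheory.Balaban1983to89.B7Prop9General

open B7Prop1Explicit MatrixLog B7Eq92Concrete B7Eq99Concrete B7Eq84Concrete B7Prop9Flat
open B7Prop6Flat (norm_units_inv_sub_one_le)

-- `Site` alone would resolve to the torus sites of `Setup.lean`; re-export the `ℤ^d` sites of `B7Prop1Explicit`.
export B7Prop1Explicit (Site)

variable {d : ℕ}

/-! ## §1 Clamping a site into a box (the localisation device) -/

section Clamp

/-- Clamp an integer into `[lo, up]`. [folklore] -/
def clampZ (lo up t : ℤ) : ℤ := max lo (min up t)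

/-- `clampZ_of_mem`: inside the interval the clamp is the identity. [folklore] -/
private theorem clampZ_of_mem {lo up t : ℤ} (h1 : lo ≤ t) (h2 : t ≤ up) : clampZ lo up t = t := by
  simp only [clampZ, max_def, min_def]; split_ifs <;> omega

/-- `lo_le_clampZ`: the clamp is at least `lo`. [folklore] -/
private theorem lo_le_clampZ (lo up t : ℤ) : lo ≤ clampZ lo up t := by
  simp only [clampZ, max_def, min_def]; split_ifs <;> omega

/-- `clampZ_le_up`: the clamp is at most `up` (for a nonempty interval). [folklore] -/
private theorem clampZ_le_up {lo up : ℤ} (h : lo ≤ up) (t : ℤ) : clampZ lo up t ≤ up := by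
  simp only [clampZ, max_def, min_def]; split_ifs <;> omega

/-- `clampZ_succ`: moving the argument by `+1` moves the clamp by `0` or by `+1` (and then stays `≤ up`). [folklore] -/
private theorem clampZ_succ {lo up : ℤ} (h : lo ≤ up) (t : ℤ) :
    clampZ lo up (t + 1) = clampZ lo up t ∨
      (clampZ lo up (t + 1) = clampZ lo up t + 1 ∧ clampZ lo up t + 1 ≤ up) := by
  simp only [clampZ, max_def, min_def]; split_ifs <;> omega

/-- Coordinatewise clamp of a site of `ℤ^d` into the box `[lo, up]`. [folklore] -/
def clamp (lo up x : Site d) : Site d := fun i => clampZ (lo i) (up i) (x i)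

/-- `clamp_of_inBox`: the clamp fixes the box pointwise. [folklore] -/
private theorem clamp_of_inBox {lo up x : Site d} (h : (∀ i, lo i ≤ x i ∧ x i ≤ up i)) : clamp lo up x = x := by
  funext i; exact clampZ_of_mem (h i).1 (h i).2

/-- `clamp_inBox`: the clamp lands in the box. [folklore] -/
private theorem clamp_inBox {lo up : Site d} (h : ∀ i, lo i ≤ up i) (x : Site d) : (∀ i, lo i ≤ (clamp lo up x) i ∧ (clamp lo up x) i ≤ up i) :=
  fun i => ⟨lo_le_clampZ _ _ _, clampZ_le_up (h i) _⟩

/-- `clamp_add_e`: the clamps of the two ends of a bond `⟨x, x + e_κ⟩` either coincide or form a bond of the box.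
[folklore] -/
private theorem clamp_add_e {lo up : Site d} (h : ∀ i, lo i ≤ up i) (x : Site d) (κ : Fin d) :
    clamp lo up (x + e κ) = clamp lo up x ∨
      (clamp lo up (x + e κ) = clamp lo up x + e κ ∧ (∀ i, lo i ≤ (clamp lo up x + e κ) i ∧ (clamp lo up x + e κ) i ≤ up i)) := by
  have he1 : ∀ y : Site d, (y + e κ) κ = y κ + 1 := fun y => by simp [e_apply]
  have he0 : ∀ (y : Site d) (i : Fin d), i ≠ κ → (y + e κ) i = y i := fun y i hi => by simp [e_apply, hi]
  rcases clampZ_succ (h κ) (x κ) with h1 | ⟨h1, h2⟩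
  · left
    funext i
    by_cases hik : i = κ
    · subst hik
      show clampZ (lo i) (up i) ((x + e i) i) = clampZ (lo i) (up i) (x i)
      rw [he1]; exact h1
    · show clampZ (lo i) (up i) ((x + e κ) i) = clampZ (lo i) (up i) (x i)
      rw [he0 x i hik]
  · right
    refine ⟨?_, fun i => ?_⟩
    · funext i
      by_cases hik : i = κ
      · subst hik
        show clampZ (lo i) (up i) ((x + e i) i) = (clamp lo up x + e i) i
        rw [he1, he1]; exact h1
      · show clampZ (lo i) (up i) ((x + e κ) i) = (clamp lo up x + e κ) i
        rw [he0 x i hik, he0 _ i hik]; rfl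
    · by_cases hik : i = κ
      · subst hik
        rw [he1]
        show lo i ≤ clampZ (lo i) (up i) (x i) + 1 ∧ clampZ (lo i) (up i) (x i) + 1 ≤ up i
        exact ⟨by have := lo_le_clampZ (lo i) (up i) (x i); omega, h2⟩
      · rw [he0 _ i hik]
        exact ⟨lo_le_clampZ _ _ _, clampZ_le_up (h i) _⟩

/-- `l1_sub_le_of_inBox`: in the box `[q, q + M]` the `ℓ¹` distance to the corner is at most `dM`. [folklore] -/
private theorem l1_sub_le_of_inBox {q p : Site d} {M : ℕ} (h : ∀ i, q i ≤ p i ∧ p i ≤ q i + M) :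
    l1 (p - q) ≤ d * M := by
  unfold l1
  calc ∑ κ, ((p - q) κ).natAbs ≤ ∑ _κ : Fin d, M := Finset.sum_le_sum fun κ _ => by
          have := h κ; simp only [Pi.sub_apply]; omega
    _ = d * M := by simp

/-- The top corner offset of the block `B(q) = q + [0, L)^d`: all coordinates `L − 1`. [folklore] -/
def boxTop (d L : ℕ) : Site d := fun _ => (L : ℤ) - 1

/-- `inBox_add_boxVec`: the block points `q + r`, `r ∈ [0, L)^d`, lie in the box `[q, q + boxTop]`. [folklore] -/
private theorem inBox_add_boxVec {L : ℕ} (q : Site d) (r : Fin d → Fin L) :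
    (∀ i, q i ≤ (q + boxVec L r) i ∧ (q + boxVec L r) i ≤ (q + boxTop d L) i) := by
  intro i
  have := (r i).isLt
  simp only [Pi.add_apply, boxVec, boxTop]
  omega

/-- `inBox_self`: the corner lies in its block (`L ≥ 1`). [folklore] -/
private theorem inBox_self {L : ℕ} (hL : 1 ≤ L) (q : Site d) : (∀ i, q i ≤ q i ∧ q i ≤ (q + boxTop d L) i) := by
  intro i
  simp only [Pi.add_apply, boxTop]
  omega

/-- `boxTop_le`: the block box is nonempty (`L ≥ 1`). [folklore] -/
private theorem le_add_boxTop {L : ℕ} (hL : 1 ≤ L) (q : Site d) : ∀ i, q i ≤ (q + boxTop d L) i := by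
  intro i
  simp only [Pi.add_apply, boxTop]
  omega

/-- `l1_le_of_inBox_block`: a point of the block box is within `ℓ¹` distance `d(L − 1) ≤ dL` of the corner. [folklore] -/
private theorem l1_le_of_inBox_block {L : ℕ} (hL : 1 ≤ L) {q p : Site d} (h : (∀ i, q i ≤ p i ∧ p i ≤ (q + boxTop d L) i)) :
    (l1 (p - q) : ℝ) ≤ d * L := by
  have h' : ∀ i, q i ≤ p i ∧ p i ≤ q i + (L - 1 : ℕ) := fun i => by
    have := h i; simp only [Pi.add_apply, boxTop] at this; constructor <;> omega
  have h1 := l1_sub_le_of_inBox h'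
  have h2 : (l1 (p - q) : ℝ) ≤ d * (L - 1 : ℕ) := by exact_mod_cast h1
  have h3 : ((L - 1 : ℕ) : ℝ) ≤ L := by
    have : ((L - 1 : ℕ) : ℝ) = (L : ℝ) - 1 := by rw [Nat.cast_sub hL, Nat.cast_one]
    linarith
  exact h2.trans (mul_le_mul_of_nonneg_left h3 (Nat.cast_nonneg d))

end Clamp

/-! ## §2 The rotated site function, clamped to a box, and the transfer of the flat hypotheses (180) -/

section Rot

variable {𝔸 : Type*} [NormedRing 𝔸] [NormOneClass 𝔸] [NormedAlgebra ℂ 𝔸] [CompleteSpace 𝔸]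

omit [NormOneClass 𝔸] [NormedAlgebra ℂ 𝔸] [CompleteSpace 𝔸] in
/-- **(180b) at a general background** `V₀` (print p. 46: "`|v′⁻¹(b₋)R_{0,b}v′(b₊) − 1| < α′₄`", `R_{0,b} = R(V_{0,b})`,
(56) `R(X)Y = XYX⁻¹`): for every bond `b = ⟨x, x + e_κ⟩` of `ℤ^d`, `‖v(x)⁻¹·R(V₀(b))v(x + e_κ) − 1‖ ≤ α` (`≤` for `<`).
At `V₀ = 1` this is `B7Prop9Flat.BondBd` (`covBondBd_one_left`). [cite: Balaban1985Averaging, (180) p.46, (177) p.45, (56) p.27] -/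
def CovBondBd (V₀ : Site d → Fin d → 𝔸ˣ) (v : Site d → 𝔸ˣ) (α : ℝ) : Prop :=
  ∀ (x : Site d) (κ : Fin d), ‖((((v x)⁻¹ * Rc (V₀ x κ) (v (x + e κ)) : 𝔸ˣ)) : 𝔸) - 1‖ ≤ α

omit [NormOneClass 𝔸] [NormedAlgebra ℂ 𝔸] [CompleteSpace 𝔸] in
/-- **(180d) at a general background** (print p. 46: "`|v₁⁻¹(y)(R₀v₁)(x) − 1| < Lα′₃, x ∈ B(y), y ∈ Ω′^{(1)}`"), with
`(R₀v₁)(x) = (R_{0,y}v₁)(x) = R(V₀(Γ_{y,x}))v₁(x)` (`B7Eq99Concrete.R0fun`, the display after (59) p. 27), block corners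
`y = Lz`, block points `x = Lz + r`, `r ∈ [0, L)^d`; `β` stands for `Lα′₃`.  This is the `j = 0` instance of the shape of (167)
(`B7Eq167Flat.Cond167`, cf. `B7Prop8General.cond167_iff_R0fun`); at `V₀ = 1` it is `B7Prop9Flat.BlockBd` (`covBlockBd_one_left`).
[cite: Balaban1985Averaging, (180) p.46, (167) p.44, p.27 (display after (59))] -/
def CovBlockBd (L : ℕ) (V₀ : Site d → Fin d → 𝔸ˣ) (v : Site d → 𝔸ˣ) (β : ℝ) : Prop :=
  ∀ (z : Site d) (r : Fin d → Fin L),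
    ‖((((v ((L : ℤ) • z))⁻¹ * R0fun V₀ ((L : ℤ) • z) v ((L : ℤ) • z + boxVec L r) : 𝔸ˣ)) : 𝔸) - 1‖ ≤ β

omit [NormOneClass 𝔸] [NormedAlgebra ℂ 𝔸] [CompleteSpace 𝔸] in
/-- `covBondBd_one_left`: at `V₀ = 1`, (180b) is the flat `BondBd`. [cite: Balaban1985Averaging, (180) p.46] -/
theorem covBondBd_one_left (v : Site d → 𝔸ˣ) (α : ℝ) :
    CovBondBd (1 : Site d → Fin d → 𝔸ˣ) v α ↔ BondBd v α := by
  simp only [CovBondBd, BondBd, Pi.one_apply, Rc_one_apply]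

omit [NormOneClass 𝔸] [NormedAlgebra ℂ 𝔸] [CompleteSpace 𝔸] in
/-- `covBlockBd_one_left`: at `V₀ = 1`, (180d) is the flat `BlockBd`. [cite: Balaban1985Averaging, (180) p.46] -/
theorem covBlockBd_one_left (L : ℕ) (v : Site d → 𝔸ˣ) (β : ℝ) :
    CovBlockBd L (1 : Site d → Fin d → 𝔸ˣ) v β ↔ BlockBd L v β := by
  simp only [CovBlockBd, BlockBd, R0fun_one_left]

omit [NormOneClass 𝔸] [NormedAlgebra ℂ 𝔸] [CompleteSpace 𝔸] in
/-- **The rotated site function, clamped to a box**: `x ↦ R(w(x̂))v(x̂)`, `x̂ = clamp(x)`.  With `w = V₀(Γ_{y,·})` the axial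
gauge function of `B7Prop1Explicit.axialFn`, on the block `B(y)` this IS print's `(R_{0,y}v)(x) = R(V₀(Γ_{y,x}))v(x)` (p. 27,
display after (59); `B7Eq99Concrete.R0fun`), and the twisted average (78) `R̄₀v` at `y` reads only these values
(`R0avg_eq_savg_rotClamp`); outside the block the function is continued constantly along the clamping, so that the GLOBAL flat
bond hypothesis of `B7Prop9Flat` only sees bonds of the block. [cite: Balaban1985Averaging, p.27 (display after (59)), (78) p.30] -/
def rotClamp (w : Site d → 𝔸ˣ) (lo up : Site d) (v : Site d → 𝔸ˣ) : Site d → 𝔸ˣ :=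
  fun x => Rc (w (clamp lo up x)) (v (clamp lo up x))

omit [NormOneClass 𝔸] [NormedAlgebra ℂ 𝔸] [CompleteSpace 𝔸] in
/-- `rotClamp_apply`: unfolding. [folklore] -/
private theorem rotClamp_apply (w : Site d → 𝔸ˣ) (lo up : Site d) (v : Site d → 𝔸ˣ) (x : Site d) :
    rotClamp w lo up v x = Rc (w (clamp lo up x)) (v (clamp lo up x)) := rfl

omit [NormOneClass 𝔸] [NormedAlgebra ℂ 𝔸] [CompleteSpace 𝔸] in
/-- `rotClamp_mul`: rotation is multiplicative ((57) "R(X)" is an automorphism), so `R(w)(v₁v₂) = (R(w)v₁)(R(w)v₂)` — the first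
equality of (168)/(182) for the rotated data. [cite: Balaban1985Averaging, (57) p.27, (182) p.46] -/
theorem rotClamp_mul (w : Site d → 𝔸ˣ) (lo up : Site d) (v₁ v₂ : Site d → 𝔸ˣ) :
    rotClamp w lo up (v₁ * v₂) = rotClamp w lo up v₁ * rotClamp w lo up v₂ := by
  funext x; simp only [rotClamp, Pi.mul_apply, map_mul]

omit [NormedAlgebra ℂ 𝔸] [CompleteSpace 𝔸] in
/-- `‖R(u)X − 1‖ ≤ ‖X − 1‖` for `u ∈ U1` (print: equality, `R(u)` is an isometry for unitary `u`). [folklore] -/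
private theorem norm_Rc_sub_one_le {u : 𝔸ˣ} (hu : u ∈ U1 𝔸) (X : 𝔸ˣ) :
    ‖((Rc u X : 𝔸ˣ) : 𝔸) - 1‖ ≤ ‖(X : 𝔸) - 1‖ := by
  rw [Rc_apply, Units.val_mul, Units.val_mul]
  exact norm_units_conj_sub_one_le hu _

omit [NormedAlgebra ℂ 𝔸] [CompleteSpace 𝔸] in
/-- `‖R(K)X − X‖ ≤ 2‖K − 1‖‖X − 1‖` for `K ∈ U1`: a rotation close to the identity moves `X` by the product of the two
deviations (`R(K)X − X = (K − 1)(X − 1)K⁻¹ + (X − 1)(K⁻¹ − 1)`) — the mechanism of (194) "`= 1 + v′⁻¹(c₋)[R(V₀(…)) − 1](v′(c₋) − 1)`".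
[cite: Balaban1985Averaging, (194) p.48] -/
theorem norm_Rc_sub_self_le {K : 𝔸ˣ} (hK : K ∈ U1 𝔸) (X : 𝔸ˣ) :
    ‖((Rc K X : 𝔸ˣ) : 𝔸) - X‖ ≤ 2 * ‖(K : 𝔸) - 1‖ * ‖(X : 𝔸) - 1‖ := by
  have h1 : (K : 𝔸) * ((K⁻¹ : 𝔸ˣ) : 𝔸) = 1 := Units.mul_inv K
  have hid : ((Rc K X : 𝔸ˣ) : 𝔸) - X = ((K : 𝔸) - 1) * ((X : 𝔸) - 1) * ((K⁻¹ : 𝔸ˣ) : 𝔸)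
      + ((X : 𝔸) - 1) * (((K⁻¹ : 𝔸ˣ) : 𝔸) - 1) := by
    rw [Rc_apply, Units.val_mul, Units.val_mul]
    have : ((K : 𝔸) - 1) * ((X : 𝔸) - 1) * ((K⁻¹ : 𝔸ˣ) : 𝔸) + ((X : 𝔸) - 1) * (((K⁻¹ : 𝔸ˣ) : 𝔸) - 1)
        = (K : 𝔸) * X * ((K⁻¹ : 𝔸ˣ) : 𝔸) - X + (1 - (K : 𝔸) * ((K⁻¹ : 𝔸ˣ) : 𝔸)) := by noncomm_ring
    rw [this, h1, sub_self, add_zero]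
  have hKi1 : ‖((K⁻¹ : 𝔸ˣ) : 𝔸)‖ ≤ 1 := (mem_U1.mp hK).2
  have hKi : ‖((K⁻¹ : 𝔸ˣ) : 𝔸) - 1‖ ≤ ‖(K : 𝔸) - 1‖ := norm_inv_sub_one_le hK
  rw [hid]
  calc _ ≤ ‖((K : 𝔸) - 1) * ((X : 𝔸) - 1) * ((K⁻¹ : 𝔸ˣ) : 𝔸)‖ + ‖((X : 𝔸) - 1) * (((K⁻¹ : 𝔸ˣ) : 𝔸) - 1)‖ :=
        norm_add_le _ _
    _ ≤ ‖(K : 𝔸) - 1‖ * ‖(X : 𝔸) - 1‖ * 1 + ‖(X : 𝔸) - 1‖ * ‖(K : 𝔸) - 1‖ := by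
        gcongr
        · exact (norm_mul_le _ _).trans (mul_le_mul (norm_mul_le _ _) hKi1 (norm_nonneg _) (by positivity))
        · exact (norm_mul_le _ _).trans (mul_le_mul_of_nonneg_left hKi (norm_nonneg _))
    _ = 2 * ‖(K : 𝔸) - 1‖ * ‖(X : 𝔸) - 1‖ := by ring

omit [NormedAlgebra ℂ 𝔸] [CompleteSpace 𝔸] in
/-- **(180a)/(176) transfers to the rotated data**: `‖R(w(x̂))v(x̂) − 1‖ ≤ ‖v(x̂) − 1‖ ≤ α` for `w` with values in `U1`
(print: "`R(·)` is an isometry"). [cite: Balaban1985Averaging, (180) p.46, (57) p.27] -/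
theorem siteBd_rotClamp {w : Site d → 𝔸ˣ} (hw : ∀ x, w x ∈ U1 𝔸) (lo up : Site d) {v : Site d → 𝔸ˣ} {α : ℝ}
    (hv : SiteBd v α) : SiteBd (rotClamp w lo up v) α :=
  fun _ => (norm_Rc_sub_one_le (hw _) _).trans (hv _)

omit [NormedAlgebra ℂ 𝔸] [CompleteSpace 𝔸] in
/-- **(180b) transfers to the rotated data, at the price of the background's bond deviation in the gauge `w`**: if every
bond `b` of the box has `‖w(b₋)V₀(b)w(b₊)⁻¹ − 1‖ ≤ g` (for the axial gauge: the thin loops `Γ_{y,b₋} ∪ b ∪ Γ_{y,b₊}⁻¹`,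
`B7Prop1Explicit.axial_bond_bound`), `‖v − 1‖ ≤ α₄ ≤ ½` and (180b) holds with `α′`, then the clamped rotated function satisfies
the FLAT bond hypothesis `B7Prop9Flat.BondBd` with `α′ + 4gα₄` on ALL bonds of `ℤ^d` (bonds collapsed by the clamp contribute `0`).
Mechanism: `(R(w_p)v_p)⁻¹R(w_{p′})v_{p′} = R(w_p)[v_p⁻¹·R(K)(R(V₀(b))v_{p′})]`, `K = w_p⁻¹G⁻¹w_p`, `G = w_pV₀(b)w_{p′}⁻¹`, and
`‖R(K)X − X‖ ≤ 2‖K − 1‖‖X − 1‖` (the device of (194)). [cite: Balaban1985Averaging, (180)–(182) p.46, (186) p.46, (194) p.48] -/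
theorem bondBd_rotClamp {lo up : Site d} (hbox : ∀ i, lo i ≤ up i)
    {w : Site d → 𝔸ˣ} (hw : ∀ x, w x ∈ U1 𝔸) {V₀ : Site d → Fin d → 𝔸ˣ} (hV : ∀ x κ, V₀ x κ ∈ U1 𝔸)
    {g : ℝ} (hg0 : 0 ≤ g)
    (hG : ∀ (p : Site d) (κ : Fin d), (∀ i, lo i ≤ p i ∧ p i ≤ up i) → (∀ i, lo i ≤ (p + e κ) i ∧ (p + e κ) i ≤ up i) →
      ‖((gaugeAct w V₀ p κ : 𝔸ˣ) : 𝔸) - 1‖ ≤ g)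
    {v : Site d → 𝔸ˣ} {α₄ α' : ℝ} (h4a : SiteBd v α₄) (hα₄ : α₄ ≤ 1 / 2) (h4b : CovBondBd V₀ v α')
    (hα' : 0 ≤ α') :
    BondBd (rotClamp w lo up v) (α' + 4 * g * α₄) := by
  have hα₄0 : 0 ≤ α₄ := (norm_nonneg _).trans (h4a 0)
  intro x κ
  rcases clamp_add_e hbox x κ with h1 | ⟨h1, h2⟩
  · simp only [rotClamp, h1, inv_mul_cancel, Units.val_one, sub_self, norm_zero]
    positivity
  · set p := clamp lo up x with hp
    have hpbox : (∀ i, lo i ≤ p i ∧ p i ≤ up i) := clamp_inBox hbox x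
    rw [show rotClamp w lo up v (x + e κ) = Rc (w (p + e κ)) (v (p + e κ)) by simp only [rotClamp, h1],
      show rotClamp w lo up v x = Rc (w p) (v p) from rfl]
    set G : 𝔸ˣ := gaugeAct w V₀ p κ with hGdef
    set K : 𝔸ˣ := (w p)⁻¹ * G⁻¹ * w p with hKdef
    set X : 𝔸ˣ := Rc (V₀ p κ) (v (p + e κ)) with hXdef
    have hid : (Rc (w p) (v p))⁻¹ * Rc (w (p + e κ)) (v (p + e κ)) = Rc (w p) ((v p)⁻¹ * Rc K X) := by
      simp only [hKdef, hXdef, hGdef, gaugeAct, Rc_apply]; group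
    have hGU : G ∈ U1 𝔸 := gaugeAct_mem hV hw p κ
    have hKU : K ∈ U1 𝔸 := (U1 𝔸).mul_mem ((U1 𝔸).mul_mem ((U1 𝔸).inv_mem (hw p)) ((U1 𝔸).inv_mem hGU)) (hw p)
    have hK1 : ‖(K : 𝔸) - 1‖ ≤ g := by
      have h3 : ‖(K : 𝔸) - 1‖ ≤ ‖((G⁻¹ : 𝔸ˣ) : 𝔸) - 1‖ := by
        rw [hKdef, Units.val_mul, Units.val_mul]
        exact norm_units_inv_conj_sub_one_le (hw p) _
      exact h3.trans ((norm_inv_sub_one_le hGU).trans (hG p κ hpbox h2))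
    have hX1 : ‖(X : 𝔸) - 1‖ ≤ α₄ := (norm_Rc_sub_one_le (hV p κ) _).trans (h4a _)
    have hvp : ‖(((v p)⁻¹ : 𝔸ˣ) : 𝔸)‖ ≤ 2 := by
      have h5 := norm_units_inv_sub_one_le (v p) ((h4a p).trans hα₄)
      calc ‖(((v p)⁻¹ : 𝔸ˣ) : 𝔸)‖ = ‖((((v p)⁻¹ : 𝔸ˣ) : 𝔸) - 1) + 1‖ := by rw [sub_add_cancel]
        _ ≤ ‖(((v p)⁻¹ : 𝔸ˣ) : 𝔸) - 1‖ + ‖(1 : 𝔸)‖ := norm_add_le _ _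
        _ ≤ 2 * α₄ + 1 := by rw [norm_one]; linarith [h4a p]
        _ ≤ 2 := by linarith
    have hmove : ‖((Rc K X : 𝔸ˣ) : 𝔸) - X‖ ≤ 2 * g * α₄ := by
      calc _ ≤ 2 * ‖(K : 𝔸) - 1‖ * ‖(X : 𝔸) - 1‖ := norm_Rc_sub_self_le hKU X
        _ ≤ 2 * g * α₄ := by gcongr
    have hY : ‖((((v p)⁻¹ * Rc K X : 𝔸ˣ)) : 𝔸) - 1‖ ≤ α' + 4 * g * α₄ := by
      have hsplit : ((((v p)⁻¹ * Rc K X : 𝔸ˣ)) : 𝔸) - 1 =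
          (((((v p)⁻¹ * X : 𝔸ˣ)) : 𝔸) - 1) + (((v p)⁻¹ : 𝔸ˣ) : 𝔸) * (((Rc K X : 𝔸ˣ) : 𝔸) - X) := by
        simp only [Units.val_mul]; noncomm_ring
      rw [hsplit]
      calc _ ≤ ‖((((v p)⁻¹ * X : 𝔸ˣ)) : 𝔸) - 1‖ + ‖(((v p)⁻¹ : 𝔸ˣ) : 𝔸) * (((Rc K X : 𝔸ˣ) : 𝔸) - X)‖ :=
            norm_add_le _ _
        _ ≤ α' + 2 * (2 * g * α₄) := by
            gcongr
            · exact h4b p κ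
            · exact (norm_mul_le _ _).trans (mul_le_mul hvp hmove (norm_nonneg _) (by norm_num))
        _ = α' + 4 * g * α₄ := by ring
    rw [hid]
    exact (norm_Rc_sub_one_le (hw p) _).trans hY

omit [NormOneClass 𝔸] [NormedAlgebra ℂ 𝔸] [CompleteSpace 𝔸] in
/-- **The block quantity of (180d) on the rotated data, in the axial gauge at the corner `q`**: `w = V₀(Γ_{q,·})` has
`w(q) = 1` and `R(w(q + r))v(q + r) = (R_{0,q}v)(q + r)`, so `(R(w)v)(q)⁻¹(R(w)v)(q + r) = v(q)⁻¹(R_{0,q}v)(q + r)` — literally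
the expression of (180d)/(167). [cite: Balaban1985Averaging, (180) p.46, p.27 (display after (59))] -/
theorem rotClamp_axial_block {L : ℕ} (hL : 1 ≤ L) (V₀ : Site d → Fin d → 𝔸ˣ) (v : Site d → 𝔸ˣ) (q : Site d)
    (r : Fin d → Fin L) :
    (rotClamp (axialFn V₀ q) q (q + boxTop d L) v q)⁻¹ * rotClamp (axialFn V₀ q) q (q + boxTop d L) v (q + boxVec L r)
      = (v q)⁻¹ * R0fun V₀ q v (q + boxVec L r) := by
  rw [rotClamp_apply, rotClamp_apply, clamp_of_inBox (inBox_self hL q), clamp_of_inBox (inBox_add_boxVec q r),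
    R0fun_add]
  simp [axialFn]

omit [NormOneClass 𝔸] in
/-- **(78) reads only the block**: the twisted average `(R̄₀v)(q) = {(R_{0,q}v)(x)}_{x∈B(q)}` (`B7Eq99Concrete.R0avg`) is the
FLAT site average `B7Eq99Concrete.savg` of the clamped rotated function in the axial gauge at `q`.
[cite: Balaban1985Averaging, (78) p.30, p.27 (display after (59))] -/
theorem R0avg_eq_savg_rotClamp {L : ℕ} (hL : 1 ≤ L) (V₀ : Site d → Fin d → 𝔸ˣ) (v : Site d → 𝔸ˣ) (q : Site d) :
    R0avg L V₀ v q = savg L (rotClamp (axialFn V₀ q) q (q + boxTop d L) v) q := by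
  refine savg_congr L ?_ fun r => ?_
  · rw [R0fun_self, rotClamp_apply, clamp_of_inBox (inBox_self hL q)]
    simp [axialFn]
  · rw [R0fun_add, rotClamp_apply, clamp_of_inBox (inBox_add_boxVec q r)]
    simp [axialFn]

end Rot

/-! ## §3 (198)/(200) at a general background -/

section Eq200

variable {𝔸 : Type*} [NormedRing 𝔸] [NormOneClass 𝔸] [NormedAlgebra ℂ 𝔸] [CompleteSpace 𝔸]

/-- **(198)/(200) AT A GENERAL BACKGROUND `V₀`, kernel form with explicit constants.**  Print (p. 49): "From
representation (184) we obtain also `|ṽ′(y) − 1| < α₄ + O(Lα′₄) + O(L²(α′₃ + α′₄)α′₄) ≦ α₄ + O(Lα′₄)`. (198) …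
**Proposition 9.** … `|ṽ′(y) − 1| < α₄ + C′₅Lα′₄`. (200)", where `ṽ′ = \overline{R₀v′v₁}(\overline{R₀v₁})⁻¹` ((178)–(179), one
step) and the averages are the twisted block averages (78) at the background `V₀` with `|V₀(∂p) − 1| < α₀` ((180), first line).
HERE: `V₀` with values in `U1 = {‖u‖ ≤ 1, ‖u⁻¹‖ ≤ 1}` (print: `G ⊂ U(N)`), `‖V₀(∂p) − 1‖ ≤ α₀` on all unit plaquettes, `v′, v₁`
with (180a) `‖v′ − 1‖ ≤ α₄ ≤ ½`, (180b) `CovBondBd V₀ v′ α′₄`, (180c) `‖v₁ − 1‖ ≤ α₃ ≤ 1/5`, (180d) `CovBlockBd L V₀ v₁ (Lα′₃)` with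
`50Lα′₃ ≤ 1`, and the smallness `10³(d+1)L·a′ ≤ 1`, `a′ := α′₄ + 4dL·α₀α₄`; then at every block corner `y = Lz`:
`‖(R̄₀(v′v₁))(y)·((R̄₀v₁)(y))⁻¹ − 1‖ ≤ α₄ + C′₅L·a′ = α₄ + C′₅Lα′₄ + 4dC′₅L²α₀α₄`, `C′₅ = 64(d+1)` (`B7Prop9Flat.C5'`).
PROOF = REDUCTION TO THE FLAT KERNEL `B7Prop9Flat.core200`: in the axial gauge `w = V₀(Γ_{y,·})` (`B7Prop1Explicit.axialFn`)
the twisted average (78) is the flat average of the rotated function `x ↦ R(V₀(Γ_{y,x}))v(x)` (`R0avg_eq_savg_rotClamp`), which —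
clamped to the block — satisfies the flat (180) with `α′₄ ↦ a′` (`bondBd_rotClamp` + `B7Prop1Explicit.axial_bond_bound`: the thin
loops `Γ_{y,b₋} ∪ b ∪ Γ_{y,b₊}⁻¹` of the block deviate from `1` by `≤ |b₋ − y|₁α₀ ≤ dLα₀`).
READING (recorded): print's (198)/(200) carry NO `α₀`-term (the product (186) along `Γ_{y,x}` only meets covariant bond
variables); the term `4dC′₅L²α₀α₄` here is the price of using the flat kernel as a black box (its bond hypothesis is global, so
the non-tree bonds of the block enter) — an honest weakening with explicit constant, inside print's "constants depend on `d`
(and `L`)" regime of `B7Prop9Flat` reading (e).  At `V₀ = 1` (`α₀ = 0`) the statement is `B7Prop9Flat.prop9_flat`'s (200).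
[cite: Balaban1985Averaging, Proposition 9 (200) p.49, (198) p.49, (180)–(184) p.46, (78) p.30] -/
theorem eq200_general {L : ℕ} (hL : 1 ≤ L) {V₀ : Site d → Fin d → 𝔸ˣ} (hV : ∀ x κ, V₀ x κ ∈ U1 𝔸)
    {α₀ : ℝ} (hα₀ : 0 ≤ α₀)
    (h44 : ∀ (x : Site d) (κ μ : Fin d), κ ≠ μ → ‖((hol V₀ x (plaqWord κ μ) : 𝔸ˣ) : 𝔸) - 1‖ ≤ α₀)
    {v' v₁ : Site d → 𝔸ˣ} {α₃ α₃' α₄ α₄' : ℝ}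
    (h4a : SiteBd v' α₄) (h4b : CovBondBd V₀ v' α₄') (h3c : SiteBd v₁ α₃) (h3d : CovBlockBd L V₀ v₁ (L * α₃'))
    (hα₄ : α₄ ≤ 1 / 2) (hα₄' : 0 ≤ α₄') (hα₃ : α₃ ≤ 1 / 5) (hα₃' : 50 * (L * α₃') ≤ 1)
    (hs : 1000 * ((d : ℝ) + 1) * L * (α₄' + 4 * (d * L * α₀) * α₄) ≤ 1) (z : Site d) :
    ‖(((R0avg L V₀ (v' * v₁) ((L : ℤ) • z) * (R0avg L V₀ v₁ ((L : ℤ) • z))⁻¹ : 𝔸ˣ)) : 𝔸) - 1‖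
      ≤ α₄ + C5' d * L * (α₄' + 4 * (d * L * α₀) * α₄) := by
  set q : Site d := (L : ℤ) • z with hq
  set w : Site d → 𝔸ˣ := axialFn V₀ q with hwdef
  set W' : Site d → 𝔸ˣ := rotClamp w q (q + boxTop d L) v' with hW'
  set W₁ : Site d → 𝔸ˣ := rotClamp w q (q + boxTop d L) v₁ with hW₁
  set a' : ℝ := α₄' + 4 * (d * L * α₀) * α₄ with ha'
  have hα₄0 : 0 ≤ α₄ := (norm_nonneg _).trans (h4a 0)
  have hw : ∀ x, w x ∈ U1 𝔸 := fun x => axialFn_mem hV q x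
  have hbox := le_add_boxTop hL q
  -- the flat hypotheses for the rotated data
  have hG : ∀ (p : Site d) (κ : Fin d), (∀ i, q i ≤ p i ∧ p i ≤ (q + boxTop d L) i) → (∀ i, q i ≤ (p + e κ) i ∧ (p + e κ) i ≤ (q + boxTop d L) i) →
      ‖((gaugeAct w V₀ p κ : 𝔸ˣ) : 𝔸) - 1‖ ≤ d * L * α₀ := by
    intro p κ hp _
    refine (axial_bond_bound V₀ hV q h44 hα₀ p κ).trans ?_
    exact mul_le_mul_of_nonneg_right (l1_le_of_inBox_block hL hp) hα₀
  have hg0 : 0 ≤ (d : ℝ) * L * α₀ := by positivity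
  have h4bW : BondBd W' a' := bondBd_rotClamp hbox hw hV hg0 hG h4a hα₄ h4b hα₄'
  have h4aW : SiteBd W' α₄ := siteBd_rotClamp hw _ _ h4a
  have h3cW : SiteBd W₁ α₃ := siteBd_rotClamp hw _ _ h3c
  have ha'0 : 0 ≤ a' := by rw [ha']; positivity
  obtain ⟨hVA, h4, ha0, ha2, hθ0, hθ1, hθ2⟩ := setup hL h4bW ha'0 hs
  have hL' : (1 : ℝ) ≤ L := by exact_mod_cast hL
  have hK : (1 : ℝ) ≤ (d : ℝ) + 1 := by have := Nat.cast_nonneg (α := ℝ) d; linarith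
  have hw' : ∀ x, ‖((W₁ x : 𝔸ˣ) : 𝔸) - 1‖ ≤ 2 / 5 := fun x => (h3cW x).trans (by linarith)
  have hwi : ∀ x, ‖((((W₁ x)⁻¹ : 𝔸ˣ)) : 𝔸) - 1‖ ≤ 2 / 5 := fun x =>
    (norm_units_inv_sub_one_le (W₁ x) ((h3cW x).trans (by linarith))).trans (by linarith [h3cW x])
  have hq1 : (L : ℝ) * α₃' ≤ 1 / 50 := by linarith
  have hqb : ∀ r : Fin d → Fin L, ‖((((W₁ q)⁻¹ * W₁ (q + boxVec L r) : 𝔸ˣ)) : 𝔸) - 1‖ ≤ L * α₃' := by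
    intro r
    rw [hW₁, hwdef, rotClamp_axial_block hL]
    exact h3d z r
  -- the identity: the twisted quotient IS the flat quotient of the rotated data
  have hid : R0avg L V₀ (v' * v₁) q * (R0avg L V₀ v₁ q)⁻¹ = savg L (W' * W₁) q * (savg L W₁ q)⁻¹ := by
    rw [R0avg_eq_savg_rotClamp hL, R0avg_eq_savg_rotClamp hL, rotClamp_mul]
  have key := core200 hL ha0 hVA hθ0 hθ1 le_rfl hwi hw' hq1 (by linarith) q hqb (h4aW q)
  rw [hid]
  have h2 := arith200 hK hL' ha'0 h4 hq1
  calc _ ≤ _ := key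
    _ ≤ α₄ + 64 * ((d : ℝ) + 1) * L * a' := by linarith
    _ = _ := by rw [C5']

end Eq200


/-! ## §4 Tree contours split at a direction (the word bookkeeping of the crossing bonds) -/

section Words

/-- The components of `v` in the directions processed by `treeWord` BEFORE `μ` (indices `> μ`). [folklore] -/
def hiPart (μ : Fin d) (v : Site d) : Site d := fun κ => if μ < κ then v κ else 0

/-- The components of `v` in the directions processed by `treeWord` AFTER `μ` (indices `< μ`). [folklore] -/
def loPart (μ : Fin d) (v : Site d) : Site d := fun κ => if κ < μ then v κ else 0

/-- `v = hiPart + v_μ e_μ + loPart`. [folklore] -/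
private theorem hiPart_add_smul_add_loPart (μ : Fin d) (v : Site d) :
    hiPart μ v + v μ • e μ + loPart μ v = v := by
  funext κ
  rcases lt_trichotomy μ κ with h | rfl | h
  · simp [hiPart, loPart, e_apply, h, ne_of_gt h, lt_asymm h]
  · simp [hiPart, loPart, e_apply]
  · simp [hiPart, loPart, e_apply, h, ne_of_lt h, lt_asymm h]

/-- The parts of a vector assembled from a `hi` vector, a multiple of `e_μ` and a `lo` vector. [folklore] -/
private theorem parts_of_sum (μ : Fin d) (a b : Site d) (c : ℤ) (ha : ∀ κ, ¬ μ < κ → a κ = 0)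
    (hb : ∀ κ, ¬ κ < μ → b κ = 0) :
    hiPart μ (a + c • e μ + b) = a ∧ loPart μ (a + c • e μ + b) = b ∧ (a + c • e μ + b) μ = c := by
  refine ⟨funext fun κ => ?_, funext fun κ => ?_, ?_⟩
  · by_cases h : μ < κ
    · simp [hiPart, h, e_apply, ne_of_gt h, hb κ (lt_asymm h)]
    · simp [hiPart, h, ha κ h]
  · by_cases h : κ < μ
    · simp [loPart, h, e_apply, ne_of_lt h, ha κ (lt_asymm h)]
    · simp [loPart, h, hb κ h]
  · simp [e_apply, ha μ (lt_irrefl μ), hb μ (lt_irrefl μ)]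

/-- `l1_hiPart_le`: dropping components does not increase the `ℓ¹` norm. [folklore] -/
private theorem l1_hiPart_le (μ : Fin d) (v : Site d) : l1 (hiPart μ v) ≤ l1 v := by
  unfold l1
  exact Finset.sum_le_sum fun κ _ => by simp only [hiPart]; split_ifs <;> simp

/-- `seg_zero`: the empty segment. [folklore] -/
private theorem seg_zero (κ : Fin d) : seg κ 0 = [] := by
  show seg κ ((0 : ℕ) : ℤ) = []
  rw [seg_natCast]; rfl

/-- `flatMap_eq_nil_of`: bookkeeping. [folklore] -/
private theorem flatMap_eq_nil_of {ι : Type*} {f : ι → List (Letter d)} :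
    ∀ {s : List ι}, (∀ κ ∈ s, f κ = []) → s.flatMap f = []
  | [], _ => rfl
  | κ :: s, h => by
    rw [List.flatMap_cons, h κ (by simp), List.nil_append]
    exact flatMap_eq_nil_of fun κ' hκ' => h κ' (by simp [hκ'])

/-- **The tree contour splits at every direction**: `Γ(v) = Γ(hiPart_μ v) ∪ [segment of v_μ steps e_μ] ∪ Γ(loPart_μ v)`
(the coordinate order of `B7Prop1Explicit.treeWord` is decreasing). [cite: Balaban1985Averaging, (77) p.30, p.20] -/
theorem treeWord_split (μ : Fin d) (v : Site d) :
    treeWord v = treeWord (hiPart μ v) ++ seg μ (v μ) ++ treeWord (loPart μ v) := by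
  obtain ⟨s, t, hst⟩ := List.append_of_mem (List.mem_reverse.mpr (List.mem_finRange μ))
  have hpw : ((List.finRange d).reverse).Pairwise (fun a b => b < a) :=
    List.pairwise_reverse.mpr (List.pairwise_lt_finRange d)
  rw [hst] at hpw
  obtain ⟨-, hμt, hst'⟩ := List.pairwise_append.mp hpw
  have hs : ∀ a ∈ s, μ < a := fun a ha => hst' a ha μ (by simp)
  have ht : ∀ b ∈ t, b < μ := fun b hb => List.rel_of_pairwise_cons hμt hb
  have e1 : s.flatMap (fun κ => seg κ (hiPart μ v κ)) = s.flatMap (fun κ => seg κ (v κ)) :=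
    flatMap_congr_of fun κ hκ => by simp [hiPart, hs κ hκ]
  have e2 : t.flatMap (fun κ => seg κ (hiPart μ v κ)) = [] :=
    flatMap_eq_nil_of fun κ hκ => by simp [hiPart, lt_asymm (ht κ hκ)]
  have e3 : s.flatMap (fun κ => seg κ (loPart μ v κ)) = [] :=
    flatMap_eq_nil_of fun κ hκ => by simp [loPart, lt_asymm (hs κ hκ)]
  have e4 : t.flatMap (fun κ => seg κ (loPart μ v κ)) = t.flatMap (fun κ => seg κ (v κ)) :=
    flatMap_congr_of fun κ hκ => by simp [loPart, ht κ hκ]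
  simp only [treeWord, hst, List.flatMap_append, List.flatMap_cons, e1, e2, e3, e4]
  simp [hiPart, loPart]

/-- `treeWord_zsmul_e`: the tree contour of `n e_μ` is the straight segment — in particular the coarse-bond
contour `seg μ L = Γ(Le_μ)`. [cite: Balaban1985Averaging, p.20, (77) p.30] -/
theorem treeWord_zsmul_e (μ : Fin d) (n : ℤ) : treeWord (n • e μ : Site d) = seg μ n := by
  obtain ⟨h1, h2, h3⟩ := parts_of_sum μ 0 0 n (fun _ _ => rfl) (fun _ _ => rfl)
  simp only [zero_add, add_zero] at h1 h2 h3
  rw [treeWord_split μ, h1, h2, h3, treeWord_zero]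
  simp

end Words

/-! ## §5 Holonomies in the axial gauge: a word of length `n` from `x` deviates from `1` by `≤ n(|x − q|₁ + n)α₀` -/

section AxialWords

variable {𝔸 : Type*} [NormedRing 𝔸] [NormOneClass 𝔸]

/-- **Linear growth of the axial bond deviation integrates along words**: if `‖V(y, κ) − 1‖ ≤ |y − q|₁·α` for all
bonds (the axial-gauge bound `B7Prop1Explicit.axial_bond_bound`, p. 25 l. 3 "`|V₀,b − 1| < |b₋ − y|α₀`") and `V` has
values in `U1`, then along any word `ω` from `x`: `‖V(ω) − 1‖ ≤ |ω|(|x − q|₁ + |ω|)α`. [cite: Balaban1985Averaging, pp.24–25] -/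
theorem norm_hol_sub_one_le_of_l1 {V : Site d → Fin d → 𝔸ˣ} (hV : ∀ x κ, V x κ ∈ U1 𝔸) (q : Site d) {α : ℝ}
    (hα : 0 ≤ α) (hb : ∀ (y : Site d) (κ : Fin d), ‖((V y κ : 𝔸ˣ) : 𝔸) - 1‖ ≤ l1 (y - q) * α) :
    ∀ (ω : List (Letter d)) (x : Site d),
      ‖((hol V x ω : 𝔸ˣ) : 𝔸) - 1‖ ≤ ω.length * (l1 (x - q) + ω.length) * α
  | [], x => by simp
  | l :: ω, x => by
    rw [hol_cons, Units.val_mul, List.length_cons, Nat.cast_succ]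
    have ih := norm_hol_sub_one_le_of_l1 hV q hα hb ω (x + l.vec)
    have hmove : ∀ y : Site d, (l1 (y + l.vec - q) : ℝ) ≤ l1 (y - q) + 1 := fun y => by
      have h1 : y + l.vec - q = (y - q) + l.vec := by abel
      have h2 := l1_add_le (y - q) l.vec
      rw [l1_vec] at h2
      rw [h1]; exact_mod_cast h2
    have hstep : ‖((stepHol V x l : 𝔸ˣ) : 𝔸) - 1‖ ≤ (l1 (x - q) + 1) * α := by
      obtain ⟨κ, b⟩ := l
      cases b
      · -- backward letter: the inverse of the bond at `x - e κ`
        have hx : x + Letter.vec ((κ, false) : Letter d) = x - e κ := by simp [sub_eq_add_neg]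
        rw [show stepHol V x (κ, false) = (V (x + Letter.vec ((κ, false) : Letter d)) κ)⁻¹ from rfl, hx]
        refine (norm_inv_sub_one_le (hV _ _)).trans ((hb _ _).trans ?_)
        have := hmove x
        rw [hx] at this  -- careful: hmove is about `x + l.vec` with l = (κ,false)
        exact mul_le_mul_of_nonneg_right this hα
      · rw [stepHol_true]
        refine (hb x κ).trans (mul_le_mul_of_nonneg_right (by linarith) hα)
    have hn1 : ‖((stepHol V x l : 𝔸ˣ) : 𝔸)‖ ≤ 1 := (mem_U1.mp (stepHol_mem hV x l)).1
    have hlen : (0 : ℝ) ≤ ω.length := Nat.cast_nonneg _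
    have hl1 : (0 : ℝ) ≤ l1 (x - q) := Nat.cast_nonneg _
    calc _ ≤ ‖((stepHol V x l : 𝔸ˣ) : 𝔸) - 1‖ + ‖((hol V (x + l.vec) ω : 𝔸ˣ) : 𝔸) - 1‖ :=
          B8Ineq170.norm_mul_sub_one_le_of_norm_le_one hn1
      _ ≤ (l1 (x - q) + 1) * α + ω.length * (l1 (x + l.vec - q) + ω.length) * α := add_le_add hstep ih
      _ ≤ (l1 (x - q) + 1) * α + ω.length * (l1 (x - q) + 1 + ω.length) * α := by
          have := hmove x
          gcongr
      _ ≤ (ω.length + 1) * (l1 (x - q) + (ω.length + 1)) * α := by nlinarith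

end AxialWords

/-! ## §6 The crossing bonds of (199): the gauge that is axial at `q` on `B(q)` and `V₀(c)`·axial at `q′` on `B(q′)` -/

section Crossing

variable {𝔸 : Type*} [NormedRing 𝔸] [NormOneClass 𝔸] [NormedAlgebra ℂ 𝔸] [CompleteSpace 𝔸]

omit [NormedAlgebra ℂ 𝔸] [CompleteSpace 𝔸] in
/-- **The crossing bond `b = ⟨p, p + e_μ⟩`, `p` on the far face of `B(q)`, `p + e_μ ∈ B(q′)`, `q′ = q + Le_μ`**: the
mismatch `V₀(Γ_{q,p})·V₀(b)·(V₀(c)V₀(Γ_{q′,p+e_μ}))⁻¹` of the two transports (the loop `Γ_{q,p} ∪ b ∪ Γ_{q′,p+e_μ}⁻¹ ∪ (−c)`,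
cf. print's loops `Γ_{c,x} ∪ (−c)` of (193)–(195)) deviates from `1` by `≤ 4(d+1)²L²α₀`.  PROOF in the axial gauge at `q`
(`V^{ax} = V₀^{v₀}`, `v₀ = B7Prop1Explicit.axialFn V₀ q`, tree contours from `q` have `V^{ax}`-holonomy `1`): the mismatch equals
`V^{ax}(b)·(V^{ax}(Γ_{q′, p+e_μ}))⁻¹`, and by `treeWord_split` `V^{ax}(Γ_{q′,p+e_μ}) = V^{ax}(Γ(a) from q′)·V^{ax}([q+a, q+a+Le_μ])⁻¹`
(`a` = the pre-`μ` part of `p − q`); each factor is a word of `≤ 2dL` resp. `L` bonds at `ℓ¹`-distance `≤ 2dL + L` from `q`,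
bounded by `norm_hol_sub_one_le_of_l1` with `B7Prop1Explicit.axial_bond_bound`. [cite: Balaban1985Averaging, (193)–(195) p.48, pp.24–25] -/
theorem crossing_bound {L : ℕ} (hL : 1 ≤ L) {V₀ : Site d → Fin d → 𝔸ˣ} (hV : ∀ x κ, V₀ x κ ∈ U1 𝔸)
    {α₀ : ℝ} (hα₀ : 0 ≤ α₀)
    (h44 : ∀ (x : Site d) (κ μ : Fin d), κ ≠ μ → ‖((hol V₀ x (plaqWord κ μ) : 𝔸ˣ) : 𝔸) - 1‖ ≤ α₀)
    (q : Site d) (μ : Fin d) (p : Site d) (hpμ : p μ = q μ + L - 1) (hl1 : (l1 (p - q) : ℝ) ≤ 2 * d * L) :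
    ‖((axialFn V₀ q p * V₀ p μ *
        (hol V₀ q (seg μ L) * axialFn V₀ (q + (L : ℤ) • e μ) (p + e μ))⁻¹ : 𝔸ˣ) : 𝔸) - 1‖
      ≤ 4 * ((d : ℝ) + 1) ^ 2 * L ^ 2 * α₀ := by
  set w : Site d → 𝔸ˣ := axialFn V₀ q with hw
  set q' : Site d := q + (L : ℤ) • e μ with hq'
  set Vax : Site d → Fin d → 𝔸ˣ := gaugeAct w V₀ with hVax
  set r : Site d := p - q with hr
  set a : Site d := hiPart μ r with ha
  set b : Site d := loPart μ r with hb
  have hVaxU : ∀ x κ, Vax x κ ∈ U1 𝔸 := gaugeAct_mem hV (axialFn_mem hV q)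
  have hbd : ∀ (y : Site d) (κ : Fin d), ‖((Vax y κ : 𝔸ˣ) : 𝔸) - 1‖ ≤ l1 (y - q) * α₀ :=
    fun y κ => axial_bond_bound V₀ hV q h44 hα₀ y κ
  have hrμ : r μ = (L : ℤ) - 1 := by simp only [hr, Pi.sub_apply, hpμ]; ring
  have hp : p = q + r := by rw [hr, add_sub_cancel]
  have haμ : ∀ κ, ¬ μ < κ → a κ = 0 := fun κ h => by simp [ha, hiPart, h]
  have hbμ : ∀ κ, ¬ κ < μ → b κ = 0 := fun κ h => by simp [hb, loPart, h]
  -- the endpoint `p + e μ = q' + (a + b)` and the full vector `a + L e_μ + b`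
  have hsum : a + ((L : ℤ) - 1) • e μ + b = r := by rw [ha, hb, ← hrμ]; exact hiPart_add_smul_add_loPart μ r
  have hfull : a + (L : ℤ) • e μ + b = r + e μ := by
    rw [← hsum, show (L : ℤ) • e μ = ((L : ℤ) - 1) • e μ + e μ by rw [sub_smul, one_smul, sub_add_cancel]]
    abel
  have hend : p + e μ = q' + (a + b) := by
    rw [hp, hq', add_assoc q r, ← hfull]; abel
  -- (i) the coarse transporter times the `q'`-axial transport is the `V₀`-holonomy of `seg ++ Γ(a+b)` from `q`
  set ω₂ : List (Letter d) := seg μ (L : ℤ) ++ treeWord (a + b) with hω₂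
  have hdisp : q + disp ω₂ = p + e μ := by
    rw [hω₂, disp_append, disp_seg, disp_treeWord, hend, hq']; abel
  have hS : hol V₀ q (seg μ L) * axialFn V₀ q' (p + e μ) = hol V₀ q ω₂ := by
    rw [hω₂, hol_append, disp_seg, axialFn, hend, add_sub_cancel_left]
  -- (ii) pass to the axial gauge: `hol V₀ q ω = hol Vax q ω * w (q + disp ω)` since `w q = 1`
  have hwq : w q = 1 := by simp [hw, axialFn]
  have hhol : hol V₀ q ω₂ = hol Vax q ω₂ * w (p + e μ) := by
    have h1 := hol_gaugeAct w V₀ q ω₂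
    rw [← hVax, hdisp, hwq, one_mul] at h1
    rw [h1, inv_mul_cancel_right]
  have hG : w p * V₀ p μ * (hol V₀ q (seg μ L) * axialFn V₀ q' (p + e μ))⁻¹ = Vax p μ * (hol Vax q ω₂)⁻¹ := by
    rw [hS, hhol, show Vax p μ = w p * V₀ p μ * (w (p + e μ))⁻¹ from rfl]
    group
  -- (iii) `hol Vax q ω₂ = hol Vax q' Γ(a+b) = hol Vax q' Γ(a) * hol Vax (q'+a) Γ(b)`
  have hseg1 : hol Vax q (seg μ (L : ℤ)) = 1 := by
    rw [← treeWord_zsmul_e, hVax, hw]; exact hol_axial_treeWord V₀ q _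
  obtain ⟨hA0, hB0, hC0⟩ := parts_of_sum μ a b 0 haμ hbμ
  simp only [zero_smul, add_zero] at hA0 hB0 hC0
  have hsplit0 : treeWord (a + b) = treeWord a ++ treeWord b := by
    rw [treeWord_split μ (a + b), hA0, hB0, hC0, seg_zero]; simp
  have hω₂' : hol Vax q ω₂ = hol Vax q' (treeWord a) * hol Vax (q' + a) (treeWord b) := by
    rw [hω₂, hol_append, hseg1, one_mul, disp_seg, ← hq', hsplit0, hol_append, disp_treeWord]
  -- (iv) the tree contour of `a + L e_μ + b` from `q` has holonomy `1`
  obtain ⟨hA1, hB1, hC1⟩ := parts_of_sum μ a b (L : ℤ) haμ hbμ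
  have hsplitL : treeWord (a + (L : ℤ) • e μ + b) = treeWord a ++ seg μ (L : ℤ) ++ treeWord b := by
    rw [treeWord_split μ (a + (L : ℤ) • e μ + b), hA1, hB1, hC1]
  have hone : hol Vax (q + a) (seg μ (L : ℤ)) * hol Vax (q + a + (L : ℤ) • e μ) (treeWord b) = 1 := by
    have h1 : hol Vax q (treeWord (a + (L : ℤ) • e μ + b)) = 1 := by
      rw [hVax, hw]; exact hol_axial_treeWord V₀ q _
    have h2 : hol Vax q (treeWord a) = 1 := by rw [hVax, hw]; exact hol_axial_treeWord V₀ q _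
    rw [hsplitL, hol_append, hol_append, h2, one_mul, disp_append, disp_treeWord, disp_seg] at h1
    rw [show q + a + (L : ℤ) • e μ = q + (a + (L : ℤ) • e μ) by abel]
    exact h1
  have hb_eq : hol Vax (q' + a) (treeWord b) = (hol Vax (q + a) (seg μ (L : ℤ)))⁻¹ := by
    rw [show q' + a = q + a + (L : ℤ) • e μ by rw [hq']; abel]
    exact (inv_eq_of_mul_eq_one_right hone).symm
  -- (v) norms
  have hT1 : ‖((Vax p μ : 𝔸ˣ) : 𝔸) - 1‖ ≤ 2 * d * L * α₀ :=
    (hbd p μ).trans (mul_le_mul_of_nonneg_right (by rwa [← hr]) hα₀)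
  have hla : (l1 a : ℝ) ≤ 2 * d * L := le_trans (by exact_mod_cast l1_hiPart_le μ r) hl1
  have hLr : (1 : ℝ) ≤ L := by exact_mod_cast hL
  have hT2 : ‖((hol Vax (q + a) (seg μ (L : ℤ)) : 𝔸ˣ) : 𝔸) - 1‖ ≤ L * (2 * d * L + L) * α₀ := by
    have h1 := norm_hol_sub_one_le_of_l1 hVaxU q hα₀ hbd (seg μ (L : ℤ)) (q + a)
    rw [length_seg_nat, add_sub_cancel_left] at h1
    refine h1.trans ?_
    gcongr
  have hT3 : ‖((hol Vax q' (treeWord a) : 𝔸ˣ) : 𝔸) - 1‖ ≤ 2 * d * L * (L + 2 * d * L) * α₀ := by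
    have h1 := norm_hol_sub_one_le_of_l1 hVaxU q hα₀ hbd (treeWord a) q'
    rw [length_treeWord, hq', add_sub_cancel_left, l1_zsmul_e, Int.natAbs_natCast] at h1
    refine h1.trans ?_
    have hl0 : (0 : ℝ) ≤ l1 a := Nat.cast_nonneg _
    gcongr
  have hU2 : hol Vax (q + a) (seg μ (L : ℤ)) ∈ U1 𝔸 := hol_mem hVaxU _ _
  have hU3 : hol Vax q' (treeWord a) ∈ U1 𝔸 := hol_mem hVaxU _ _
  rw [hG, hω₂', hb_eq, mul_inv_rev, inv_inv, Units.val_mul, Units.val_mul]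
  calc _ ≤ ‖((Vax p μ : 𝔸ˣ) : 𝔸) - 1‖ +
        ‖((hol Vax (q + a) (seg μ (L : ℤ)) : 𝔸ˣ) : 𝔸) * (((hol Vax q' (treeWord a))⁻¹ : 𝔸ˣ) : 𝔸) - 1‖ :=
        B8Ineq170.norm_mul_sub_one_le_of_norm_le_one (mem_U1.mp (hVaxU p μ)).1
    _ ≤ ‖((Vax p μ : 𝔸ˣ) : 𝔸) - 1‖ + (‖((hol Vax (q + a) (seg μ (L : ℤ)) : 𝔸ˣ) : 𝔸) - 1‖ +
        ‖(((hol Vax q' (treeWord a))⁻¹ : 𝔸ˣ) : 𝔸) - 1‖) := by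
        gcongr
        exact B8Ineq170.norm_mul_sub_one_le_of_norm_le_one (mem_U1.mp hU2).1
    _ ≤ 2 * d * L * α₀ + (L * (2 * d * L + L) * α₀ + 2 * d * L * (L + 2 * d * L) * α₀) :=
        add_le_add hT1 (add_le_add hT2 ((norm_inv_sub_one_le hU3).trans hT3))
    _ ≤ 4 * ((d : ℝ) + 1) ^ 2 * L ^ 2 * α₀ := by
        have hd : (0 : ℝ) ≤ d := Nat.cast_nonneg d
        have hL2 : (L : ℝ) ≤ (L : ℝ) ^ 2 := by nlinarith
        have : 2 * d * L * α₀ ≤ 2 * d * L ^ 2 * α₀ := by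
          have := mul_le_mul_of_nonneg_left hL2 (by positivity : (0 : ℝ) ≤ 2 * d * α₀); nlinarith
        nlinarith

end Crossing

/-! ## §7 (197)/(199) at a general background -/

section Eq199

variable {𝔸 : Type*} [NormedRing 𝔸] [NormOneClass 𝔸] [NormedAlgebra ℂ 𝔸] [CompleteSpace 𝔸]

omit [NormOneClass 𝔸] in
/-- **`ṽ′` at a general background, fine base point** `y`: `ṽ′(y) = \overline{R₀v′v₁}(y)·(\overline{R₀v₁}(y))⁻¹`, the
one-step operation of (178)/(179) with the twisted averages (78) `B7Eq99Concrete.R0avg` at `V₀` (print indexes `ṽ′` by the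
coarse site; here by the block corner `y = Lz`).  At `V₀ = 1`: `B7Prop9Flat.vtil` (`vtilG_one_left`).
[cite: Balaban1985Averaging, (178)–(179) p.45, (78) p.30] -/
def vtilG (L : ℕ) (V₀ : Site d → Fin d → 𝔸ˣ) (v' v₁ : Site d → 𝔸ˣ) (y : Site d) : 𝔸ˣ :=
  R0avg L V₀ (v' * v₁) y * (R0avg L V₀ v₁ y)⁻¹

omit [NormOneClass 𝔸] in
/-- `vtilG_one_left`: at the flat background, `ṽ′` is `B7Prop9Flat.vtil`. [cite: Balaban1985Averaging, (179) p.45] -/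
theorem vtilG_one_left (L : ℕ) (v' v₁ : Site d → 𝔸ˣ) (z : Site d) :
    vtilG L (1 : Site d → Fin d → 𝔸ˣ) v' v₁ ((L : ℤ) • z) = vtil L v' v₁ z := by
  rw [vtilG, R0avg_one_left, R0avg_one_left, vtil_apply]

omit [NormOneClass 𝔸] in
/-- `eq200_general` in the `vtilG` notation. [cite: Balaban1985Averaging, Proposition 9 (200) p.49] -/
theorem vtilG_apply (L : ℕ) (V₀ : Site d → Fin d → 𝔸ˣ) (v' v₁ : Site d → 𝔸ˣ) (y : Site d) :
    vtilG L V₀ v' v₁ y = R0avg L V₀ (v' * v₁) y * (R0avg L V₀ v₁ y)⁻¹ := rfl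

/-- **(78) is covariant under a constant rotation**: `{R(T)g(x)}_{x∈B(y)} = R(T){g(x)}_{x∈B(y)}` for `T ∈ U1` when the block
quantities `g(y)⁻¹g(x)` lie in the disc of the logarithm (termwise conjugation of the series (21), `B7Prop1Explicit.mlog_units_conj`;
(57) "R(X)f(Y) = f(R(X)Y) for analytic functions f"). [cite: Balaban1985Averaging, (57) p.27, (78) p.30, (21)–(23) p.21] -/
theorem savg_Rc {L : ℕ} {T : 𝔸ˣ} (hT : T ∈ U1 𝔸) {g : Site d → 𝔸ˣ} {y : Site d}
    (hg : ∀ r : Fin d → Fin L, ‖((((g y)⁻¹ * g (y + boxVec L r) : 𝔸ˣ)) : 𝔸) - 1‖ < 1) :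
    savg L (fun x => Rc T (g x)) y = Rc T (savg L g y) := by
  have hS : Sexp L (fun x => Rc T (g x)) y = (T : 𝔸) * Sexp L g y * ((T⁻¹ : 𝔸ˣ) : 𝔸) := by
    simp only [Sexp_apply, Finset.mul_sum, Finset.sum_mul]
    refine Finset.sum_congr rfl fun r _ => ?_
    rw [← map_inv, ← map_mul, Rc_apply, Units.val_mul, Units.val_mul, mlog_units_conj hT (hg r), mul_smul_comm,
      smul_mul_assoc]
  rw [savg_apply, savg_apply, hS, expUnit_conj, ← map_mul]

omit [NormedAlgebra ℂ 𝔸] [CompleteSpace 𝔸] in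
/-- The block quantity of the PRODUCT `v′v₁` ((181)/(182): "`(v′v₁)⁻¹(y)(R_{0,y}v′v₁)(x) = R(v₁⁻¹(y))[v′⁻¹(y)(R_{0,y}v′)(x)]·
v₁⁻¹(y)(R_{0,y}v₁)(x)`") lies in the disc of the logarithm: `‖… − 1‖ < 1` for `‖v′ − 1‖ ≤ α₄ ≤ 1/10`, `‖v₁ − 1‖ ≤ 1/5` and
`‖v₁⁻¹(y)(R_{0,y}v₁)(x) − 1‖ ≤ 1/50`. [cite: Balaban1985Averaging, (181)–(182) p.46] -/
theorem prod_block_lt_one {V₀ : Site d → Fin d → 𝔸ˣ} (hV : ∀ x κ, V₀ x κ ∈ U1 𝔸) {v' v₁ : Site d → 𝔸ˣ}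
    {α₃ α₄ β : ℝ} (h4a : SiteBd v' α₄) (h3c : SiteBd v₁ α₃) (hα₄ : α₄ ≤ 1 / 10) (hα₃ : α₃ ≤ 1 / 5)
    {y x : Site d} (hB : ‖((((v₁ y)⁻¹ * R0fun V₀ y v₁ x : 𝔸ˣ)) : 𝔸) - 1‖ ≤ β) (hβ : β ≤ 1 / 50) :
    ‖(((((v' * v₁) y)⁻¹ * R0fun V₀ y (v' * v₁) x : 𝔸ˣ)) : 𝔸) - 1‖ < 1 := by
  set A : 𝔸ˣ := (v' y)⁻¹ * R0fun V₀ y v' x with hA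
  set B : 𝔸ˣ := (v₁ y)⁻¹ * R0fun V₀ y v₁ x with hB'
  set u : 𝔸ˣ := (v₁ y)⁻¹ with hu
  have hid : ((v' * v₁) y)⁻¹ * R0fun V₀ y (v' * v₁) x = Rc u A * B := by
    simp only [hA, hB', hu, Pi.mul_apply, R0fun_apply, map_mul, Rc_apply]; group
  have hα₄0 : 0 ≤ α₄ := (norm_nonneg _).trans (h4a 0)
  have hα₃0 : 0 ≤ α₃ := (norm_nonneg _).trans (h3c 0)
  have hR : ‖((R0fun V₀ y v' x : 𝔸ˣ) : 𝔸) - 1‖ ≤ α₄ := by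
    rw [R0fun_apply]; exact (norm_Rc_sub_one_le (hol_mem hV _ _) _).trans (h4a x)
  have hvi : ‖(((v' y)⁻¹ : 𝔸ˣ) : 𝔸) - 1‖ ≤ 2 * α₄ :=
    (norm_units_inv_sub_one_le (v' y) ((h4a y).trans (by linarith))).trans (by linarith [h4a y])
  have hvin : ‖(((v' y)⁻¹ : 𝔸ˣ) : 𝔸)‖ ≤ 2 := by
    calc _ = ‖((((v' y)⁻¹ : 𝔸ˣ) : 𝔸) - 1) + 1‖ := by rw [sub_add_cancel]
      _ ≤ ‖(((v' y)⁻¹ : 𝔸ˣ) : 𝔸) - 1‖ + ‖(1 : 𝔸)‖ := norm_add_le _ _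
      _ ≤ 2 := by rw [norm_one]; linarith
  have hA1 : ‖(A : 𝔸) - 1‖ ≤ 4 * α₄ := by
    have : (A : 𝔸) - 1 = (((v' y)⁻¹ : 𝔸ˣ) : 𝔸) * (((R0fun V₀ y v' x : 𝔸ˣ) : 𝔸) - 1) +
        ((((v' y)⁻¹ : 𝔸ˣ) : 𝔸) - 1) := by
      simp only [hA, Units.val_mul]; noncomm_ring
    rw [this]
    calc _ ≤ ‖(((v' y)⁻¹ : 𝔸ˣ) : 𝔸) * (((R0fun V₀ y v' x : 𝔸ˣ) : 𝔸) - 1)‖ + ‖(((v' y)⁻¹ : 𝔸ˣ) : 𝔸) - 1‖ :=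
          norm_add_le _ _
      _ ≤ 2 * α₄ + 2 * α₄ := by
          gcongr
          exact (norm_mul_le _ _).trans (by nlinarith [norm_nonneg ((((R0fun V₀ y v' x : 𝔸ˣ) : 𝔸) - 1))])
      _ = 4 * α₄ := by ring
  have hu1 : ‖(u : 𝔸)‖ ≤ 7 / 5 := by
    have h1 := norm_units_inv_sub_one_le (v₁ y) ((h3c y).trans (by linarith))
    calc ‖(u : 𝔸)‖ = ‖((u : 𝔸) - 1) + 1‖ := by rw [sub_add_cancel]
      _ ≤ ‖(u : 𝔸) - 1‖ + ‖(1 : 𝔸)‖ := norm_add_le _ _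
      _ ≤ 2 * ‖((v₁ y : 𝔸ˣ) : 𝔸) - 1‖ + 1 := by rw [norm_one, hu]; linarith
      _ ≤ 7 / 5 := by linarith [h3c y]
  have hu2 : ‖((u⁻¹ : 𝔸ˣ) : 𝔸)‖ ≤ 6 / 5 := by
    rw [hu, inv_inv]
    calc ‖((v₁ y : 𝔸ˣ) : 𝔸)‖ = ‖(((v₁ y : 𝔸ˣ) : 𝔸) - 1) + 1‖ := by rw [sub_add_cancel]
      _ ≤ ‖((v₁ y : 𝔸ˣ) : 𝔸) - 1‖ + ‖(1 : 𝔸)‖ := norm_add_le _ _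
      _ ≤ 6 / 5 := by rw [norm_one]; linarith [h3c y]
  have hRc : ‖((Rc u A : 𝔸ˣ) : 𝔸) - 1‖ ≤ 7 * α₄ := by
    have : ((Rc u A : 𝔸ˣ) : 𝔸) - 1 = (u : 𝔸) * ((A : 𝔸) - 1) * ((u⁻¹ : 𝔸ˣ) : 𝔸) := by
      rw [Rc_apply, Units.val_mul, Units.val_mul, mul_sub, sub_mul, mul_one, Units.mul_inv]
    rw [this]
    calc _ ≤ ‖(u : 𝔸)‖ * ‖(A : 𝔸) - 1‖ * ‖((u⁻¹ : 𝔸ˣ) : 𝔸)‖ :=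
          (norm_mul_le _ _).trans (mul_le_mul_of_nonneg_right (norm_mul_le _ _) (norm_nonneg _))
      _ ≤ 7 / 5 * (4 * α₄) * (6 / 5) := by gcongr
      _ ≤ 7 * α₄ := by linarith
  have hB1 : ‖(B : 𝔸) - 1‖ ≤ 1 / 50 := hB.trans hβ
  have hBn : ‖(B : 𝔸)‖ ≤ 51 / 50 := by
    calc ‖(B : 𝔸)‖ = ‖((B : 𝔸) - 1) + 1‖ := by rw [sub_add_cancel]
      _ ≤ ‖(B : 𝔸) - 1‖ + ‖(1 : 𝔸)‖ := norm_add_le _ _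
      _ ≤ 51 / 50 := by rw [norm_one]; linarith
  rw [hid, Units.val_mul]
  have : ((Rc u A : 𝔸ˣ) : 𝔸) * B - 1 = (((Rc u A : 𝔸ˣ) : 𝔸) - 1) * B + ((B : 𝔸) - 1) := by noncomm_ring
  rw [this]
  calc _ ≤ ‖(((Rc u A : 𝔸ˣ) : 𝔸) - 1) * B‖ + ‖(B : 𝔸) - 1‖ := norm_add_le _ _
    _ ≤ 7 * α₄ * (51 / 50) + 1 / 50 := by
        gcongr
        exact (norm_mul_le _ _).trans (mul_le_mul hRc hBn (norm_nonneg _) (by positivity))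
    _ < 1 := by linarith

omit [NormOneClass 𝔸] [NormedAlgebra ℂ 𝔸] [CompleteSpace 𝔸] in
/-- **The two-block gauge**: axial at `q` on `{x_μ < q_μ + L}` (the block `B(q)` side), and `V₀(c)·`axial at `q′ = q + Le_μ`
beyond (the block `B(q′)` side), `c = ⟨q, q′⟩` the coarse bond with its straight contour `seg μ L`.  In this gauge the twisted
average at `q` is the flat average of the rotated data and the twisted average at `q′` is `R(V₀(c))` of it
(`savg_rotClamp_gauge2_q`, `savg_rotClamp_gauge2_q'`), so that print's `ṽ′⁻¹(c₋)R_{0,c}ṽ′(c₊)` becomes the FLAT coarse bond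
variable of `B7Prop9Flat.core199`. [cite: Balaban1985Averaging, (188)–(192) pp.47–48, (78) p.30] -/
def gauge2 (V₀ : Site d → Fin d → 𝔸ˣ) (q : Site d) (μ : Fin d) (L : ℕ) (x : Site d) : 𝔸ˣ :=
  if x μ < q μ + L then axialFn V₀ q x else hol V₀ q (seg μ L) * axialFn V₀ (q + (L : ℤ) • e μ) x

/-- `le_up2`: the two-block box `[q, q + boxTop + Le_μ]` is nonempty. [folklore] -/
private theorem le_up2 {L : ℕ} (hL : 1 ≤ L) (q : Site d) (μ : Fin d) : ∀ i, q i ≤ (q + boxTop d L + (L : ℤ) • e μ) i := by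
  intro i
  simp only [Pi.add_apply, boxTop, Pi.smul_apply, e_apply, smul_eq_mul]
  split_ifs <;> omega

/-- `inBox2_block`: the points of `B(q)` lie in the two-block box. [folklore] -/
private theorem inBox2_block {L : ℕ} (hL : 1 ≤ L) (q : Site d) (μ : Fin d) (r : Fin d → Fin L) :
    (∀ i, q i ≤ (q + boxVec L r) i ∧ (q + boxVec L r) i ≤ (q + boxTop d L + (L : ℤ) • e μ) i) := by
  intro i
  have := (r i).isLt
  simp only [Pi.add_apply, boxVec, boxTop, Pi.smul_apply, e_apply, smul_eq_mul]
  split_ifs <;> omega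

/-- `inBox2_block'`: the points of `B(q′)`, `q′ = q + Le_μ`, lie in the two-block box. [folklore] -/
private theorem inBox2_block' {L : ℕ} (hL : 1 ≤ L) (q : Site d) (μ : Fin d) (r : Fin d → Fin L) :
    (∀ i, q i ≤ (q + (L : ℤ) • e μ + boxVec L r) i ∧ (q + (L : ℤ) • e μ + boxVec L r) i ≤ (q + boxTop d L + (L : ℤ) • e μ) i) := by
  intro i
  have := (r i).isLt
  simp only [Pi.add_apply, boxVec, boxTop, Pi.smul_apply, e_apply, smul_eq_mul]
  split_ifs <;> omega

/-- `inBox2_q`: the corner `q` lies in the two-block box. [folklore] -/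
private theorem inBox2_q {L : ℕ} (hL : 1 ≤ L) (q : Site d) (μ : Fin d) : (∀ i, q i ≤ q i ∧ q i ≤ (q + boxTop d L + (L : ℤ) • e μ) i) := by
  intro i
  simp only [Pi.add_apply, boxTop, Pi.smul_apply, e_apply, smul_eq_mul]
  split_ifs <;> omega

/-- `inBox2_q'`: the corner `q′ = q + Le_μ` lies in the two-block box. [folklore] -/
private theorem inBox2_q' {L : ℕ} (hL : 1 ≤ L) (q : Site d) (μ : Fin d) :
    (∀ i, q i ≤ (q + (L : ℤ) • e μ) i ∧ (q + (L : ℤ) • e μ) i ≤ (q + boxTop d L + (L : ℤ) • e μ) i) := by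
  intro i
  simp only [Pi.add_apply, boxTop, Pi.smul_apply, e_apply, smul_eq_mul]
  split_ifs <;> omega

/-- `l1_le_of_inBox2`: a point of the two-block box is within `ℓ¹` distance `2dL` of `q`. [folklore] -/
private theorem l1_le_of_inBox2 {L : ℕ} (hL : 1 ≤ L) {q : Site d} {μ : Fin d} {p : Site d}
    (h : (∀ i, q i ≤ p i ∧ p i ≤ (q + boxTop d L + (L : ℤ) • e μ) i)) : (l1 (p - q) : ℝ) ≤ 2 * d * L := by
  have h' : ∀ i, q i ≤ p i ∧ p i ≤ q i + (2 * L - 1 : ℕ) := fun i => by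
    have := h i
    simp only [Pi.add_apply, boxTop, Pi.smul_apply, e_apply, smul_eq_mul] at this
    constructor
    · exact this.1
    · have h2 := this.2; split_ifs at h2 <;> omega
  have h1 := l1_sub_le_of_inBox h'
  have h2 : (l1 (p - q) : ℝ) ≤ d * (2 * L - 1 : ℕ) := by exact_mod_cast h1
  have h3 : ((2 * L - 1 : ℕ) : ℝ) ≤ 2 * L := by
    have : ((2 * L - 1 : ℕ) : ℝ) = 2 * (L : ℝ) - 1 := by
      rw [Nat.cast_sub (by omega), Nat.cast_mul, Nat.cast_ofNat, Nat.cast_one]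
    linarith
  calc (l1 (p - q) : ℝ) ≤ d * (2 * L - 1 : ℕ) := h2
    _ ≤ d * (2 * L) := mul_le_mul_of_nonneg_left h3 (Nat.cast_nonneg d)
    _ = 2 * d * L := by ring

omit [NormedAlgebra ℂ 𝔸] [CompleteSpace 𝔸] in
/-- **The bonds of the two-block box in the gauge `gauge2` deviate from `1` by `≤ 4(d+1)²L²α₀`**: inside `B(q)` and inside
`B(q′)` these are the thin loops of `B7Prop1Explicit.axial_bond_bound` (`≤ (2d+1)Lα₀`), across the face they are the crossing
loops of `crossing_bound`. [cite: Balaban1985Averaging, (186)–(187) pp.46–47, (193)–(195) p.48, pp.24–25] -/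
theorem gauge2_bond_bound {L : ℕ} (hL : 1 ≤ L) {V₀ : Site d → Fin d → 𝔸ˣ} (hV : ∀ x κ, V₀ x κ ∈ U1 𝔸)
    {α₀ : ℝ} (hα₀ : 0 ≤ α₀)
    (h44 : ∀ (x : Site d) (κ μ : Fin d), κ ≠ μ → ‖((hol V₀ x (plaqWord κ μ) : 𝔸ˣ) : 𝔸) - 1‖ ≤ α₀)
    (q : Site d) (μ : Fin d) {p : Site d} {κ : Fin d} (hp : (∀ i, q i ≤ p i ∧ p i ≤ (q + boxTop d L + (L : ℤ) • e μ) i))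
    (hp' : (∀ i, q i ≤ (p + e κ) i ∧ (p + e κ) i ≤ (q + boxTop d L + (L : ℤ) • e μ) i)) :
    ‖((gaugeAct (gauge2 V₀ q μ L) V₀ p κ : 𝔸ˣ) : 𝔸) - 1‖ ≤ 4 * ((d : ℝ) + 1) ^ 2 * L ^ 2 * α₀ := by
  have hl1p : (l1 (p - q) : ℝ) ≤ 2 * d * L := l1_le_of_inBox2 hL hp
  have hd : (0 : ℝ) ≤ d := Nat.cast_nonneg d
  have hLr : (1 : ℝ) ≤ L := by exact_mod_cast hL
  have hbig : (2 * d * L + L) * α₀ ≤ 4 * ((d : ℝ) + 1) ^ 2 * L ^ 2 * α₀ := by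
    apply mul_le_mul_of_nonneg_right _ hα₀
    nlinarith
  by_cases h1 : p μ < q μ + L
  · by_cases h2 : (p + e κ) μ < q μ + L
    · -- inside `B(q)`: axial gauge at `q`
      have : gaugeAct (gauge2 V₀ q μ L) V₀ p κ = gaugeAct (axialFn V₀ q) V₀ p κ := by
        simp only [gaugeAct, gauge2, if_pos h1, if_pos h2]
      rw [this]
      calc _ ≤ (l1 (p - q)) * α₀ := axial_bond_bound V₀ hV q h44 hα₀ p κ
        _ ≤ (2 * d * L + L) * α₀ := by apply mul_le_mul_of_nonneg_right _ hα₀; linarith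
        _ ≤ _ := hbig
    · -- the crossing bond: `κ = μ`, `p` on the far face of `B(q)`
      have hκ : κ = μ := by
        by_contra hne
        apply h2
        have : (p + e κ) μ = p μ := by simp [e_apply, Ne.symm hne]
        rw [this]; exact h1
      subst hκ
      have hpμ : p κ = q κ + L - 1 := by
        have : (p + e κ) κ = p κ + 1 := by simp [e_apply]
        rw [this] at h2
        omega
      have hG : gaugeAct (gauge2 V₀ q κ L) V₀ p κ = axialFn V₀ q p * V₀ p κ *
          (hol V₀ q (seg κ L) * axialFn V₀ (q + (L : ℤ) • e κ) (p + e κ))⁻¹ := by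
        simp only [gaugeAct, gauge2, if_pos h1, if_neg h2]
      rw [hG]
      exact crossing_bound hL hV hα₀ h44 q κ p hpμ hl1p
  · -- inside `B(q′)`: `V₀(c)`·(axial gauge at `q′`)
    have h2 : ¬ (p + e κ) μ < q μ + L := by
      intro h
      apply h1
      have : p μ ≤ (p + e κ) μ := by
        simp only [Pi.add_apply, e_apply]; split_ifs <;> omega
      omega
    have : gaugeAct (gauge2 V₀ q μ L) V₀ p κ =
        Rc (hol V₀ q (seg μ L)) (gaugeAct (axialFn V₀ (q + (L : ℤ) • e μ)) V₀ p κ) := by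
      simp only [gaugeAct, gauge2, if_neg h1, if_neg h2, Rc_apply]; group
    rw [this]
    have hl1' : (l1 (p - (q + (L : ℤ) • e μ)) : ℝ) ≤ 2 * d * L + L := by
      have h3 : p - (q + (L : ℤ) • e μ) = (p - q) + -((L : ℤ) • e μ) := by abel
      have h4 := l1_add_le (p - q) (-((L : ℤ) • e μ))
      rw [l1_neg, l1_zsmul_e, Int.natAbs_natCast] at h4
      rw [h3]
      calc (l1 ((p - q) + -((L : ℤ) • e μ)) : ℝ) ≤ (l1 (p - q) + L : ℕ) := by exact_mod_cast h4
        _ = l1 (p - q) + L := by push_cast; ring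
        _ ≤ _ := by linarith
    calc _ ≤ ‖((gaugeAct (axialFn V₀ (q + (L : ℤ) • e μ)) V₀ p κ : 𝔸ˣ) : 𝔸) - 1‖ :=
          norm_Rc_sub_one_le (hol_mem hV _ _) _
      _ ≤ (l1 (p - (q + (L : ℤ) • e μ))) * α₀ := axial_bond_bound V₀ hV _ h44 hα₀ p κ
      _ ≤ (2 * d * L + L) * α₀ := mul_le_mul_of_nonneg_right hl1' hα₀
      _ ≤ _ := hbig

/-- **(197)/(199) AT A GENERAL BACKGROUND `V₀`, kernel form with explicit constants, straight coarse transporter.**  Print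
(p. 49): "**Proposition 9.** There exist positive constants `C′₄, C′₅, c′₆` such that for arbitrary functions `V₀, v′, v₁`
satisfying (180) with `α₀, α₃, α′₃, α₄, α′₄ ≦ c′₆`, the following bounds hold:
`|ṽ′⁻¹(c₋)R̄_{0,c}ṽ′(c₊) − 1| < Lα′₄ + C′₄L²(α₀α₄ + α′₃α′₄ + α′₄²)`, (199)".
HERE (setting of `eq200_general`; `c = ⟨Lz, L(z + e_μ)⟩` the coarse bond, transporter `V₀(c)` = the straight contour `seg μ L`;
print's `R̄_{0,c} = R(V̄₀(c))` with the AVERAGED background (43) is `eq199_general` below): with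
`a′ := α′₄ + 16(d+1)²L²·α₀α₄` and under `10³(d+1)L·a′ ≤ 1`, `α₄ ≤ 1/10`,
`‖ṽ′(c₋)⁻¹·R(V₀(c))ṽ′(c₊) − 1‖ ≤ L·a′ + C′₄L²(α′₃a′ + a′²)`, `C′₄ = 10⁴(d+1)²` (`B7Prop9Flat.C4'`) — the flat (199) of
`B7Prop9Flat.prop9_flat` with `α′₄ ↦ a′`; expanded, the `α₀`-terms are `16(d+1)²L³α₀α₄ + O(L⁴α₀α₄(α′₃ + α′₄ + L²α₀α₄))`.
PROOF = REDUCTION TO `B7Prop9Flat.core199` in the two-block gauge `gauge2` (axial at `c₋` on `B(c₋)`, `V₀(c)`·axial at `c₊`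
on `B(c₊)`): the twisted averages become flat averages of the rotated data (`savg_Rc` for the block `B(c₊)`), the rotated data
clamped to the two blocks satisfy the flat (180) with `α′₄ ↦ a′` (`bondBd_rotClamp`, `gauge2_bond_bound`: thin loops
`B7Prop1Explicit.axial_bond_bound`, crossing loops `crossing_bound`).
READING (recorded): print's `C′₄L²α₀α₄` becomes `16(d+1)²L³α₀α₄ + …` (one power of `L` more, `d`-dependent): the flat kernel's
bond hypothesis is global, so its leading term `L·sup_b|V′_b − 1|` sees the crossing loops (area `≤ 2dL²`); inside print's
"constants depend on `d` (and `L`)" regime of `B7Prop9Flat` reading (e).  At `V₀ = 1` the statement is `prop9_flat`'s (199).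
[cite: Balaban1985Averaging, Proposition 9 (199) p.49, (197) p.48, (180)–(196) pp.46–48, (78)–(79) p.30] -/
theorem eq199_general_seg {L : ℕ} (hL : 1 ≤ L) {V₀ : Site d → Fin d → 𝔸ˣ} (hV : ∀ x κ, V₀ x κ ∈ U1 𝔸)
    {α₀ : ℝ} (hα₀ : 0 ≤ α₀)
    (h44 : ∀ (x : Site d) (κ μ : Fin d), κ ≠ μ → ‖((hol V₀ x (plaqWord κ μ) : 𝔸ˣ) : 𝔸) - 1‖ ≤ α₀)
    {v' v₁ : Site d → 𝔸ˣ} {α₃ α₃' α₄ α₄' : ℝ}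
    (h4a : SiteBd v' α₄) (h4b : CovBondBd V₀ v' α₄') (h3c : SiteBd v₁ α₃) (h3d : CovBlockBd L V₀ v₁ (L * α₃'))
    (hα₄ : α₄ ≤ 1 / 10) (hα₄' : 0 ≤ α₄') (hα₃ : α₃ ≤ 1 / 5) (hα₃' : 50 * (L * α₃') ≤ 1)
    (hs : 1000 * ((d : ℝ) + 1) * L * (α₄' + 16 * ((d : ℝ) + 1) ^ 2 * L ^ 2 * α₀ * α₄) ≤ 1)
    (z : Site d) (μ : Fin d) :
    ‖((((vtilG L V₀ v' v₁ ((L : ℤ) • z))⁻¹ *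
        Rc (hol V₀ ((L : ℤ) • z) (seg μ L)) (vtilG L V₀ v' v₁ ((L : ℤ) • (z + e μ))) : 𝔸ˣ)) : 𝔸) - 1‖
      ≤ L * (α₄' + 16 * ((d : ℝ) + 1) ^ 2 * L ^ 2 * α₀ * α₄) +
        C4' d * L ^ 2 * (α₃' * (α₄' + 16 * ((d : ℝ) + 1) ^ 2 * L ^ 2 * α₀ * α₄) +
          (α₄' + 16 * ((d : ℝ) + 1) ^ 2 * L ^ 2 * α₀ * α₄) ^ 2) := by
  set q : Site d := (L : ℤ) • z with hq
  have hq'z : (L : ℤ) • (z + e μ) = q + (L : ℤ) • e μ := by rw [hq, smul_add]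
  set S : 𝔸ˣ := hol V₀ q (seg μ L) with hSdef
  set ŵ : Site d → 𝔸ˣ := gauge2 V₀ q μ L with hŵ
  set up : Site d := q + boxTop d L + (L : ℤ) • e μ with hup
  set W' : Site d → 𝔸ˣ := rotClamp ŵ q up v' with hW'
  set W₁ : Site d → 𝔸ˣ := rotClamp ŵ q up v₁ with hW₁
  set a' : ℝ := α₄' + 16 * ((d : ℝ) + 1) ^ 2 * L ^ 2 * α₀ * α₄ with ha'
  have hα₄0 : 0 ≤ α₄ := (norm_nonneg _).trans (h4a 0)
  have hS : S ∈ U1 𝔸 := hol_mem hV _ _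
  have hŵU : ∀ x, ŵ x ∈ U1 𝔸 := fun x => by
    simp only [hŵ, gauge2]
    split_ifs
    · exact axialFn_mem hV _ _
    · exact (U1 𝔸).mul_mem (hol_mem hV _ _) (axialFn_mem hV _ _)
  have hbox := le_up2 hL q μ
  -- the flat hypotheses for the rotated data
  have hg0 : 0 ≤ 4 * ((d : ℝ) + 1) ^ 2 * L ^ 2 * α₀ := by positivity
  have hG : ∀ (p : Site d) (κ : Fin d), (∀ i, q i ≤ p i ∧ p i ≤ up i) → (∀ i, q i ≤ (p + e κ) i ∧ (p + e κ) i ≤ up i) →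
      ‖((gaugeAct ŵ V₀ p κ : 𝔸ˣ) : 𝔸) - 1‖ ≤ 4 * ((d : ℝ) + 1) ^ 2 * L ^ 2 * α₀ :=
    fun p κ hp hp' => gauge2_bond_bound hL hV hα₀ h44 q μ hp hp'
  have h4bW : BondBd W' a' := by
    have h := bondBd_rotClamp hbox hŵU hV hg0 hG h4a (hα₄.trans (by norm_num)) h4b hα₄'
    rw [hW', ha']
    convert h using 2
    ring
  have h4aW : SiteBd W' α₄ := siteBd_rotClamp hŵU _ _ h4a
  have h3cW : SiteBd W₁ α₃ := siteBd_rotClamp hŵU _ _ h3c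
  have ha'0 : 0 ≤ a' := by rw [ha']; positivity
  obtain ⟨hVA, h4, ha0, ha2, hθ0, hθ1, hθ2⟩ := setup hL h4bW ha'0 hs
  have hL' : (1 : ℝ) ≤ L := by exact_mod_cast hL
  have hK : (1 : ℝ) ≤ (d : ℝ) + 1 := by have := Nat.cast_nonneg (α := ℝ) d; linarith
  have hw' : ∀ x, ‖((W₁ x : 𝔸ˣ) : 𝔸) - 1‖ ≤ 2 / 5 := fun x => (h3cW x).trans (by linarith)
  have hwi : ∀ x, ‖((((W₁ x)⁻¹ : 𝔸ˣ)) : 𝔸) - 1‖ ≤ 2 / 5 := fun x =>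
    (norm_units_inv_sub_one_le (W₁ x) ((h3cW x).trans (by linarith))).trans (by linarith [h3cW x])
  have hq1 : (L : ℝ) * α₃' ≤ 1 / 50 := by linarith
  have hq0 : 0 ≤ (L : ℝ) * α₃' := (norm_nonneg _).trans (h3d 0 fun _ => ⟨0, hL⟩)
  -- the values of the gauge on the two blocks
  have hLz : (1 : ℤ) ≤ L := by exact_mod_cast hL
  have hŵq : ŵ q = 1 := by
    have : q μ < q μ + L := by omega
    rw [hŵ, gauge2, if_pos this]
    simp [axialFn]
  have hŵblk : ∀ r : Fin d → Fin L, ŵ (q + boxVec L r) = hol V₀ q (treeWord (boxVec L r)) := by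
    intro r
    have : (q + boxVec L r) μ < q μ + L := by
      have := (r μ).isLt; simp only [Pi.add_apply, boxVec]; omega
    rw [hŵ, gauge2, if_pos this, axialFn, add_sub_cancel_left]
  have hŵq' : ŵ (q + (L : ℤ) • e μ) = S := by
    have : ¬ (q + (L : ℤ) • e μ) μ < q μ + L := by simp [e_apply]
    rw [hŵ, gauge2, if_neg this]
    simp [axialFn, hSdef]
  have hŵblk' : ∀ r : Fin d → Fin L, ŵ (q + (L : ℤ) • e μ + boxVec L r) =
      S * hol V₀ (q + (L : ℤ) • e μ) (treeWord (boxVec L r)) := by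
    intro r
    have : ¬ (q + (L : ℤ) • e μ + boxVec L r) μ < q μ + L := by
      simp [e_apply, boxVec]
    rw [hŵ, gauge2, if_neg this, axialFn, add_sub_cancel_left]
  -- the block quantities of (180d) for the rotated `v₁`
  have hqb : ∀ r : Fin d → Fin L, ‖((((W₁ q)⁻¹ * W₁ (q + boxVec L r) : 𝔸ˣ)) : 𝔸) - 1‖ ≤ L * α₃' := by
    intro r
    have : (W₁ q)⁻¹ * W₁ (q + boxVec L r) = (v₁ q)⁻¹ * R0fun V₀ q v₁ (q + boxVec L r) := by
      rw [hW₁, rotClamp_apply, rotClamp_apply, clamp_of_inBox (inBox2_q hL q μ),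
        clamp_of_inBox (inBox2_block hL q μ r), hŵq, hŵblk, R0fun_add, Rc_one_apply]
    rw [this]; exact h3d z r
  have hqb' : ∀ r : Fin d → Fin L, ‖((((W₁ (q + (L : ℤ) • e μ))⁻¹ *
      W₁ (q + (L : ℤ) • e μ + boxVec L r) : 𝔸ˣ)) : 𝔸) - 1‖ ≤ L * α₃' := by
    intro r
    have : (W₁ (q + (L : ℤ) • e μ))⁻¹ * W₁ (q + (L : ℤ) • e μ + boxVec L r) =
        Rc S ((v₁ (q + (L : ℤ) • e μ))⁻¹ * R0fun V₀ (q + (L : ℤ) • e μ) v₁ (q + (L : ℤ) • e μ + boxVec L r)) := by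
      rw [hW₁, rotClamp_apply, rotClamp_apply, clamp_of_inBox (inBox2_q' hL q μ),
        clamp_of_inBox (inBox2_block' hL q μ r), hŵq', hŵblk', R0fun_add, map_mul, map_inv, Rc_mul,
        MonoidHom.comp_apply]
    rw [this]
    refine (norm_Rc_sub_one_le hS _).trans ?_
    have := h3d (z + e μ) r
    rwa [hq'z] at this
  -- the twisted averages ARE flat averages of the rotated data
  have hid_q : ∀ v : Site d → 𝔸ˣ, savg L (rotClamp ŵ q up v) q = R0avg L V₀ v q := fun v => by
    refine savg_congr L ?_ fun r => ?_
    · rw [rotClamp_apply, clamp_of_inBox (inBox2_q hL q μ), hŵq, R0fun_self, Rc_one_apply]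
    · rw [rotClamp_apply, clamp_of_inBox (inBox2_block hL q μ r), hŵblk, R0fun_add]
  have hid_q' : ∀ v : Site d → 𝔸ˣ,
      (∀ r : Fin d → Fin L, ‖((((v (q + (L : ℤ) • e μ))⁻¹ *
        R0fun V₀ (q + (L : ℤ) • e μ) v (q + (L : ℤ) • e μ + boxVec L r) : 𝔸ˣ)) : 𝔸) - 1‖ < 1) →
      savg L (rotClamp ŵ q up v) (q + (L : ℤ) • e μ) = Rc S (R0avg L V₀ v (q + (L : ℤ) • e μ)) := by
    intro v hv
    have h1 : savg L (rotClamp ŵ q up v) (q + (L : ℤ) • e μ) =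
        savg L (fun x => Rc S (R0fun V₀ (q + (L : ℤ) • e μ) v x)) (q + (L : ℤ) • e μ) := by
      refine savg_congr L ?_ fun r => ?_
      · rw [rotClamp_apply, clamp_of_inBox (inBox2_q' hL q μ), hŵq', R0fun_self]
      · rw [rotClamp_apply, clamp_of_inBox (inBox2_block' hL q μ r), hŵblk', R0fun_add, Rc_mul,
          MonoidHom.comp_apply]
    have hv' : ∀ r : Fin d → Fin L, ‖((((R0fun V₀ (q + (L : ℤ) • e μ) v (q + (L : ℤ) • e μ))⁻¹ *
        R0fun V₀ (q + (L : ℤ) • e μ) v (q + (L : ℤ) • e μ + boxVec L r) : 𝔸ˣ)) : 𝔸) - 1‖ < 1 := fun r => by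
      rw [R0fun_self]; exact hv r
    rw [h1, savg_Rc hS hv']
    rfl
  have hsm₁ : ∀ r : Fin d → Fin L, ‖((((v₁ (q + (L : ℤ) • e μ))⁻¹ *
      R0fun V₀ (q + (L : ℤ) • e μ) v₁ (q + (L : ℤ) • e μ + boxVec L r) : 𝔸ˣ)) : 𝔸) - 1‖ < 1 := fun r => by
    have := h3d (z + e μ) r
    rw [hq'z] at this
    exact this.trans_lt (by linarith)
  have hsm₂ : ∀ r : Fin d → Fin L, ‖(((((v' * v₁) (q + (L : ℤ) • e μ))⁻¹ *
      R0fun V₀ (q + (L : ℤ) • e μ) (v' * v₁) (q + (L : ℤ) • e μ + boxVec L r) : 𝔸ˣ)) : 𝔸) - 1‖ < 1 := fun r => by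
    have := h3d (z + e μ) r
    rw [hq'z] at this
    exact prod_block_lt_one hV h4a h3c hα₄ hα₃ this hq1
  -- the printed quantity IS the flat coarse bond variable of the rotated data
  have hid : (vtilG L V₀ v' v₁ q)⁻¹ * Rc S (vtilG L V₀ v' v₁ (q + (L : ℤ) • e μ)) =
      (savg L (W' * W₁) q * (savg L W₁ q)⁻¹)⁻¹ *
        (savg L (W' * W₁) (q + (L : ℤ) • e μ) * (savg L W₁ (q + (L : ℤ) • e μ))⁻¹) := by
    rw [hW', hW₁, ← rotClamp_mul, hid_q, hid_q, hid_q' _ hsm₂, hid_q' _ hsm₁, vtilG, vtilG, map_mul, map_inv]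
  have key := core199 hL ha0 hVA hθ0 hθ1 le_rfl hwi hw' hq1 q μ hqb hqb'
  rw [hq'z, hid]
  calc _ ≤ _ := key
    _ ≤ _ := arith199 hK hL' ha'0 h4 hq0
    _ = _ := by rw [C4', ha']; ring

end Eq199


/-! ## §8 (199) with print's rotation `R̄_{0,c} = R(V̄₀(c))`, `V̄₀` the averaged background (42)/(43) -/

section Eq199Avg

variable {𝔸 : Type*} [NormedRing 𝔸] [NormOneClass 𝔸] [NormedAlgebra ℂ 𝔸] [CompleteSpace 𝔸]

omit [NormOneClass 𝔸] [NormedAlgebra ℂ 𝔸] [CompleteSpace 𝔸] in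
/-- `R(K)Y − Y = (K − 1)(Y − 1)K⁻¹ + (Y − 1)(K⁻¹ − 1)`, in norm, for an arbitrary unit `K`. [folklore] -/
private theorem norm_Rc_sub_self_le_gen (K Y : 𝔸ˣ) :
    ‖((Rc K Y : 𝔸ˣ) : 𝔸) - Y‖ ≤ ‖(K : 𝔸) - 1‖ * ‖(Y : 𝔸) - 1‖ * ‖((K⁻¹ : 𝔸ˣ) : 𝔸)‖ +
      ‖(Y : 𝔸) - 1‖ * ‖((K⁻¹ : 𝔸ˣ) : 𝔸) - 1‖ := by
  have h1 : (K : 𝔸) * ((K⁻¹ : 𝔸ˣ) : 𝔸) = 1 := Units.mul_inv K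
  have hid : ((Rc K Y : 𝔸ˣ) : 𝔸) - Y = ((K : 𝔸) - 1) * ((Y : 𝔸) - 1) * ((K⁻¹ : 𝔸ˣ) : 𝔸)
      + ((Y : 𝔸) - 1) * (((K⁻¹ : 𝔸ˣ) : 𝔸) - 1) := by
    rw [Rc_apply, Units.val_mul, Units.val_mul]
    have : ((K : 𝔸) - 1) * ((Y : 𝔸) - 1) * ((K⁻¹ : 𝔸ˣ) : 𝔸) + ((Y : 𝔸) - 1) * (((K⁻¹ : 𝔸ˣ) : 𝔸) - 1)
        = (K : 𝔸) * Y * ((K⁻¹ : 𝔸ˣ) : 𝔸) - Y + (1 - (K : 𝔸) * ((K⁻¹ : 𝔸ˣ) : 𝔸)) := by noncomm_ring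
    rw [this, h1, sub_self, add_zero]
  rw [hid]
  calc _ ≤ ‖((K : 𝔸) - 1) * ((Y : 𝔸) - 1) * ((K⁻¹ : 𝔸ˣ) : 𝔸)‖ + ‖((Y : 𝔸) - 1) * (((K⁻¹ : 𝔸ˣ) : 𝔸) - 1)‖ :=
        norm_add_le _ _
    _ ≤ _ := add_le_add ((norm_mul_le _ _).trans (mul_le_mul_of_nonneg_right (norm_mul_le _ _) (norm_nonneg _)))
        (norm_mul_le _ _)

/-- **A rotation by `e^X`, `‖X‖ ≤ ξ ≤ ½`, moves `Y` by `≤ 6ξ‖Y − 1‖`** — used for the factor `e^{X_c}` of the averaged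
background bond `V̄₀(c) = e^{X_c}V₀(c)` ((42), `B7Prop1Explicit.bavg`), `‖X_c‖ = O(L²α₀)` (p. 25).
[cite: Balaban1985Averaging, (42) p.23, p.25] -/
theorem norm_Rc_expUnit_sub_self_le {X : 𝔸} {ξ : ℝ} (hX : ‖X‖ ≤ ξ) (hξ : ξ ≤ 1 / 2) (Y : 𝔸ˣ) :
    ‖((Rc (expUnit X) Y : 𝔸ˣ) : 𝔸) - Y‖ ≤ 6 * ξ * ‖(Y : 𝔸) - 1‖ := by
  have hξ0 : 0 ≤ ξ := (norm_nonneg _).trans hX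
  have hexp : Real.exp ξ - 1 ≤ 2 * ξ := by
    have h := Real.abs_exp_sub_one_le (x := ξ) (by rw [abs_of_nonneg hξ0]; linarith)
    rw [abs_of_nonneg hξ0] at h
    linarith [le_abs_self (Real.exp ξ - 1)]
  have hE1 : ‖exp X - 1‖ ≤ 2 * ξ := (norm_exp_sub_one_le_of_norm_le hX).1.trans hexp
  have hXn : ‖-X‖ ≤ ξ := by rwa [norm_neg]
  have hE2 : ‖exp (-X) - 1‖ ≤ 2 * ξ := (norm_exp_sub_one_le_of_norm_le hXn).1.trans hexp
  have hE3 : ‖exp (-X)‖ ≤ 2 := by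
    calc ‖exp (-X)‖ = ‖(exp (-X) - 1) + 1‖ := by rw [sub_add_cancel]
      _ ≤ ‖exp (-X) - 1‖ + ‖(1 : 𝔸)‖ := norm_add_le _ _
      _ ≤ 2 * ξ + 1 := by rw [norm_one]; linarith
      _ ≤ 2 := by linarith
  have h := norm_Rc_sub_self_le_gen (expUnit X) Y
  rw [val_inv_expUnit, val_expUnit, val_expUnit] at h
  have hY0 : 0 ≤ ‖(Y : 𝔸) - 1‖ := norm_nonneg _
  calc _ ≤ _ := h
    _ ≤ 2 * ξ * ‖(Y : 𝔸) - 1‖ * 2 + ‖(Y : 𝔸) - 1‖ * (2 * ξ) := by gcongr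
    _ = 6 * ξ * ‖(Y : 𝔸) - 1‖ := by ring

/-- **(199) AT A GENERAL BACKGROUND WITH PRINT'S `R̄_{0,c} = R(V̄₀(c))`** (p. 49, Proposition 9 (199):
"`|ṽ′⁻¹(c₋)R̄_{0,c}ṽ′(c₊) − 1| < Lα′₄ + C′₄L²(α₀α₄ + α′₃α′₄ + α′₄²)`"), `V̄₀ = \overline{V₀}` the averaged configuration
(42)/(43) (`B7Prop1Explicit.bavg L V₀`, `V̄₀(c) = e^{X_c}V₀(c)`), kernel form with explicit constants: the bound of
`eq199_general_seg` plus the cost `384(d+1)(d+4)L²α₀·(α₄ + C′₅L(α′₄ + 4dLα₀α₄))` of the extra rotation `R(e^{X_c})`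
(`‖X_c‖ ≤ 32(d+1)(d+4)L²α₀` by `B7Prop2Explicit.norm_Wcx_sub_one_le`, moving `R(V₀(c))ṽ′(c₊)`, which is within (200) of `1`),
under the additional smallness `512(d+1)(d+4)L²α₀ ≤ 1` of Proposition 2.  READING as in `eq199_general_seg` (α₀-terms one power
of `L` weaker than print, `d`-dependent; print's (197) term `O(L²α₀α′₄)` is the `α′₄`-part of the last summand).
[cite: Balaban1985Averaging, Proposition 9 (199) p.49, (197) p.48, (188) p.47, (42)–(43) p.23–24, p.25] -/
theorem eq199_general {L : ℕ} (hL : 1 ≤ L) {V₀ : Site d → Fin d → 𝔸ˣ} (hV : ∀ x κ, V₀ x κ ∈ U1 𝔸)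
    {α₀ : ℝ} (hα₀ : 0 ≤ α₀)
    (h44 : ∀ (x : Site d) (κ μ : Fin d), κ ≠ μ → ‖((hol V₀ x (plaqWord κ μ) : 𝔸ˣ) : 𝔸) - 1‖ ≤ α₀)
    {v' v₁ : Site d → 𝔸ˣ} {α₃ α₃' α₄ α₄' : ℝ}
    (h4a : SiteBd v' α₄) (h4b : CovBondBd V₀ v' α₄') (h3c : SiteBd v₁ α₃) (h3d : CovBlockBd L V₀ v₁ (L * α₃'))
    (hα₄ : α₄ ≤ 1 / 10) (hα₄' : 0 ≤ α₄') (hα₃ : α₃ ≤ 1 / 5) (hα₃' : 50 * (L * α₃') ≤ 1)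
    (hs : 1000 * ((d : ℝ) + 1) * L * (α₄' + 16 * ((d : ℝ) + 1) ^ 2 * L ^ 2 * α₀ * α₄) ≤ 1)
    (hα₀s : 512 * ((d : ℝ) + 1) * ((d : ℝ) + 4) * L ^ 2 * α₀ ≤ 1)
    (z : Site d) (μ : Fin d) :
    ‖((((vtilG L V₀ v' v₁ ((L : ℤ) • z))⁻¹ *
        Rc (bavg L V₀ ((L : ℤ) • z) μ) (vtilG L V₀ v' v₁ ((L : ℤ) • (z + e μ))) : 𝔸ˣ)) : 𝔸) - 1‖
      ≤ (L * (α₄' + 16 * ((d : ℝ) + 1) ^ 2 * L ^ 2 * α₀ * α₄) +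
          C4' d * L ^ 2 * (α₃' * (α₄' + 16 * ((d : ℝ) + 1) ^ 2 * L ^ 2 * α₀ * α₄) +
            (α₄' + 16 * ((d : ℝ) + 1) ^ 2 * L ^ 2 * α₀ * α₄) ^ 2)) +
        384 * ((d : ℝ) + 1) * ((d : ℝ) + 4) * L ^ 2 * α₀ * (α₄ + C5' d * L * (α₄' + 4 * (d * L * α₀) * α₄)) := by
  have hα₄0 : 0 ≤ α₄ := (norm_nonneg _).trans (h4a 0)
  have hd : (0 : ℝ) ≤ d := Nat.cast_nonneg d
  have hLr : (1 : ℝ) ≤ L := by exact_mod_cast hL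
  -- the smallness of `eq200_general` follows from the one assumed here
  have hs200 : 1000 * ((d : ℝ) + 1) * L * (α₄' + 4 * (d * L * α₀) * α₄) ≤ 1 := by
    have h1 : 4 * ((d : ℝ) * L * α₀) * α₄ ≤ 16 * ((d : ℝ) + 1) ^ 2 * L ^ 2 * α₀ * α₄ := by
      have h2 : (d : ℝ) * L ≤ 4 * ((d : ℝ) + 1) ^ 2 * L ^ 2 := by
        have hKL : 1 ≤ ((d : ℝ) + 1) * L := one_le_mul_of_one_le_of_one_le (by linarith) hLr
        have h5 : (d : ℝ) * L ≤ ((d : ℝ) + 1) * L := by nlinarith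
        have h6 : ((d : ℝ) + 1) * L ≤ (((d : ℝ) + 1) * L) ^ 2 := by nlinarith
        nlinarith
      have h3 := mul_le_mul_of_nonneg_right h2 (mul_nonneg hα₀ hα₄0)
      nlinarith
    have hpos : (0 : ℝ) ≤ 1000 * ((d : ℝ) + 1) * L := by positivity
    nlinarith [mul_le_mul_of_nonneg_left h1 hpos]
  have h199 := eq199_general_seg hL hV hα₀ h44 h4a h4b h3c h3d hα₄ hα₄' hα₃ hα₃' hs z μ
  have h200 := eq200_general hL hV hα₀ h44 h4a h4b h3c h3d (hα₄.trans (by norm_num)) hα₄' hα₃ hα₃' hs200 z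
  have h200' := eq200_general hL hV hα₀ h44 h4a h4b h3c h3d (hα₄.trans (by norm_num)) hα₄' hα₃ hα₃' hs200
    (z + e μ)
  have hq'z : (L : ℤ) • (z + e μ) = (L : ℤ) • z + (L : ℤ) • e μ := smul_add _ _ _
  rw [hq'z] at h199 h200' ⊢
  set q : Site d := (L : ℤ) • z with hq
  set S : 𝔸ˣ := hol V₀ q (seg μ L) with hSdef
  set E : 𝔸ˣ := expUnit (Xavg L V₀ q μ) with hE
  set P : 𝔸ˣ := (vtilG L V₀ v' v₁ q)⁻¹ with hP
  set Y : 𝔸ˣ := Rc S (vtilG L V₀ v' v₁ (q + (L : ℤ) • e μ)) with hY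
  set M : ℝ := α₄ + C5' d * L * (α₄' + 4 * (d * L * α₀) * α₄) with hM
  have hS : S ∈ U1 𝔸 := hol_mem hV _ _
  have hbavg : bavg L V₀ q μ = E * S := rfl
  have hM1 : M ≤ 1 / 4 := by
    have : C5' d * L * (α₄' + 4 * (d * L * α₀) * α₄) ≤ 64 / 1000 := by rw [C5']; nlinarith
    rw [hM]; linarith
  have hY1 : ‖(Y : 𝔸) - 1‖ ≤ M := (norm_Rc_sub_one_le hS _).trans h200'
  have h200v : ‖((vtilG L V₀ v' v₁ q : 𝔸ˣ) : 𝔸) - 1‖ ≤ M := h200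
  have hPn : ‖(P : 𝔸)‖ ≤ 2 := by
    have h1 := norm_units_inv_sub_one_le (vtilG L V₀ v' v₁ q) (h200v.trans (by linarith))
    calc ‖(P : 𝔸)‖ = ‖((P : 𝔸) - 1) + 1‖ := by rw [sub_add_cancel]
      _ ≤ ‖(P : 𝔸) - 1‖ + ‖(1 : 𝔸)‖ := norm_add_le _ _
      _ ≤ 2 * M + 1 := by rw [norm_one, hP]; linarith
      _ ≤ 2 := by linarith
  -- the exponent `X_c` of the averaged bond is `O(L²α₀)`
  set ξ : ℝ := 32 * ((d : ℝ) + 1) * ((d : ℝ) + 4) * L ^ 2 * α₀ with hξ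
  have hξ1 : ξ ≤ 1 / 16 := by rw [hξ]; linarith
  have hX : ‖Xavg L V₀ q μ‖ ≤ ξ := by
    unfold Xavg
    refine norm_avg_le L hL _ fun r => ?_
    have hW := B7Prop2Explicit.norm_Wcx_sub_one_le L hL V₀ hV hα₀ hα₀s h44 q μ r
    have hW' : ‖((Wcx L V₀ q μ (boxVec L r) : 𝔸ˣ) : 𝔸) - 1‖ ≤ 1 / 2 := hW.trans (by linarith)
    calc _ ≤ 2 * ‖((Wcx L V₀ q μ (boxVec L r) : 𝔸ˣ) : 𝔸) - 1‖ := norm_mlog_le_two_mul hW'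
      _ ≤ 2 * (2 * (8 * ((d : ℝ) + 1) * ((d : ℝ) + 4) * (L : ℝ) ^ 2 * α₀)) := by linarith
      _ = ξ := by rw [hξ]; ring
  have hmove : ‖((Rc E Y : 𝔸ˣ) : 𝔸) - Y‖ ≤ 6 * ξ * M :=
    (norm_Rc_expUnit_sub_self_le hX (by linarith) Y).trans (by
      have hξ0 : 0 ≤ ξ := by rw [hξ]; positivity
      gcongr)
  have hid : ((P * Rc (bavg L V₀ q μ) (vtilG L V₀ v' v₁ (q + (L : ℤ) • e μ)) : 𝔸ˣ) : 𝔸) - 1 =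
      ((((P * Y : 𝔸ˣ)) : 𝔸) - 1) + (P : 𝔸) * (((Rc E Y : 𝔸ˣ) : 𝔸) - Y) := by
    rw [hbavg, Rc_mul, MonoidHom.comp_apply, ← hY]
    simp only [Units.val_mul]
    noncomm_ring
  rw [hid]
  calc _ ≤ ‖(((P * Y : 𝔸ˣ)) : 𝔸) - 1‖ + ‖(P : 𝔸) * (((Rc E Y : 𝔸ˣ) : 𝔸) - Y)‖ := norm_add_le _ _
    _ ≤ _ + 2 * (6 * ξ * M) :=
        add_le_add h199 ((norm_mul_le _ _).trans (mul_le_mul hPn hmove (norm_nonneg _) (by norm_num)))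
    _ = _ := by rw [hξ, hM]; ring

end Eq199Avg


/-! ## §9 Proposition 9 at a general background: the conclusions are the hypotheses (180a)/(180b) one scale up,
at the averaged background `V̄₀ = rescale L (bavg L V₀) = avgIter L V₀ 1` -/

section Prop9

variable {𝔸 : Type*} [NormedRing 𝔸] [NormOneClass 𝔸] [NormedAlgebra ℂ 𝔸] [CompleteSpace 𝔸]

/-- **PROPOSITION 9 AT A GENERAL BACKGROUND** (p. 49: "There exist positive constants `C′₄, C′₅, c′₆` such that for
arbitrary functions `V₀, v′, v₁` satisfying (180) with `α₀, α₃, α′₃, α₄, α′₄ ≦ c′₆`, the following bounds hold: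
`|ṽ′⁻¹(c₋)R̄_{0,c}ṽ′(c₊) − 1| < Lα′₄ + C′₄L²(α₀α₄ + α′₃α′₄ + α′₄²)`, (199) `|ṽ′(y) − 1| < α₄ + C′₅Lα′₄`. (200)"), kernel form
over the concrete model with EXPLICIT constants, packaged exactly as the hypotheses (180b)/(180a) ONE SCALE UP: the coarse
function `z ↦ ṽ′(Lz)` satisfies `CovBondBd` at the AVERAGED background `V̄₀ = \overline{V₀}` of (42)/(43) on the coarse lattice
(`B7Prop2Explicit.rescale L (B7Prop1Explicit.bavg L V₀)` = `avgIter L V₀ 1`) with the constant of `eq199_general`, and `SiteBd`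
with the constant of `eq200_general` — the input shape of the induction (201)–(206) of Proposition 10 at a general background.
Hypotheses: `V₀` with values in `U1` and (52) `‖V₀(∂p) − 1‖ ≤ α₀` with `512(d+1)(d+4)L²α₀ ≤ 1`; (180) in the forms
`SiteBd v′ α₄` (`α₄ ≤ 1/10`), `CovBondBd V₀ v′ α′₄`, `SiteBd v₁ α₃` (`α₃ ≤ 1/5`), `CovBlockBd L V₀ v₁ (Lα′₃)` (`50Lα′₃ ≤ 1`), and
`10³(d+1)L·(α′₄ + 16(d+1)²L²α₀α₄) ≤ 1` (print's `c′₆`, depending on `d` and `L` as in `B7Prop9Flat` reading (e)).  At `V₀ = 1`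
this is `B7Prop9Flat.prop9_flat` (`covBondBd_one_left`, `vtilG_one_left`; the `α₀`-terms vanish).  READINGS: those of
`eq199_general`/`eq200_general` (α₀-terms `d`-dependent and one power of `L` weaker than print's (199), present in (200)).
[cite: Balaban1985Averaging, Proposition 9 p.49, (199)–(200) p.49, (180) p.46, (42)–(43) pp.23–24] -/
theorem prop9_general {L : ℕ} (hL : 1 ≤ L) {V₀ : Site d → Fin d → 𝔸ˣ} (hV : ∀ x κ, V₀ x κ ∈ U1 𝔸)
    {α₀ : ℝ} (hα₀ : 0 ≤ α₀)
    (h44 : ∀ (x : Site d) (κ μ : Fin d), κ ≠ μ → ‖((hol V₀ x (plaqWord κ μ) : 𝔸ˣ) : 𝔸) - 1‖ ≤ α₀)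
    {v' v₁ : Site d → 𝔸ˣ} {α₃ α₃' α₄ α₄' : ℝ}
    (h4a : SiteBd v' α₄) (h4b : CovBondBd V₀ v' α₄') (h3c : SiteBd v₁ α₃) (h3d : CovBlockBd L V₀ v₁ (L * α₃'))
    (hα₄ : α₄ ≤ 1 / 10) (hα₄' : 0 ≤ α₄') (hα₃ : α₃ ≤ 1 / 5) (hα₃' : 50 * (L * α₃') ≤ 1)
    (hs : 1000 * ((d : ℝ) + 1) * L * (α₄' + 16 * ((d : ℝ) + 1) ^ 2 * L ^ 2 * α₀ * α₄) ≤ 1)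
    (hα₀s : 512 * ((d : ℝ) + 1) * ((d : ℝ) + 4) * L ^ 2 * α₀ ≤ 1) :
    CovBondBd (B7Prop2Explicit.rescale L (bavg L V₀)) (fun z => vtilG L V₀ v' v₁ ((L : ℤ) • z))
        ((L * (α₄' + 16 * ((d : ℝ) + 1) ^ 2 * L ^ 2 * α₀ * α₄) +
            C4' d * L ^ 2 * (α₃' * (α₄' + 16 * ((d : ℝ) + 1) ^ 2 * L ^ 2 * α₀ * α₄) +
              (α₄' + 16 * ((d : ℝ) + 1) ^ 2 * L ^ 2 * α₀ * α₄) ^ 2)) +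
          384 * ((d : ℝ) + 1) * ((d : ℝ) + 4) * L ^ 2 * α₀ *
            (α₄ + C5' d * L * (α₄' + 4 * (d * L * α₀) * α₄))) ∧
      SiteBd (fun z => vtilG L V₀ v' v₁ ((L : ℤ) • z)) (α₄ + C5' d * L * (α₄' + 4 * (d * L * α₀) * α₄)) := by
  have hα₄0 : 0 ≤ α₄ := (norm_nonneg _).trans (h4a 0)
  have hd : (0 : ℝ) ≤ d := Nat.cast_nonneg d
  have hLr : (1 : ℝ) ≤ L := by exact_mod_cast hL
  have hs200 : 1000 * ((d : ℝ) + 1) * L * (α₄' + 4 * (d * L * α₀) * α₄) ≤ 1 := by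
    have h1 : 4 * ((d : ℝ) * L * α₀) * α₄ ≤ 16 * ((d : ℝ) + 1) ^ 2 * L ^ 2 * α₀ * α₄ := by
      have h2 : (d : ℝ) * L ≤ 4 * ((d : ℝ) + 1) ^ 2 * L ^ 2 := by
        have hKL : 1 ≤ ((d : ℝ) + 1) * L := one_le_mul_of_one_le_of_one_le (by linarith) hLr
        have h5 : (d : ℝ) * L ≤ ((d : ℝ) + 1) * L := by nlinarith
        have h6 : ((d : ℝ) + 1) * L ≤ (((d : ℝ) + 1) * L) ^ 2 := by nlinarith
        nlinarith
      have h3 := mul_le_mul_of_nonneg_right h2 (mul_nonneg hα₀ hα₄0)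
      nlinarith
    have hpos : (0 : ℝ) ≤ 1000 * ((d : ℝ) + 1) * L := by positivity
    nlinarith [mul_le_mul_of_nonneg_left h1 hpos]
  refine ⟨fun z μ => ?_, fun z => ?_⟩
  · simp only [B7Prop2Explicit.rescale_apply]
    exact eq199_general hL hV hα₀ h44 h4a h4b h3c h3d hα₄ hα₄' hα₃ hα₃' hs hα₀s z μ
  · exact eq200_general hL hV hα₀ h44 h4a h4b h3c h3d (hα₄.trans (by norm_num)) hα₄' hα₃ hα₃' hs200 z

end Prop9

end Literature.MathematicalPhysics.QuantumFieldTheory.Balaban1983to89.B7Prop9General
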